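/-
Copyright (c) 2026. All rights reserved.
Released under Apache 2.0 license as described in the file LICENSE.
-/
import Literature.Geometry.Kaehler.ComplexTorusQuaternionXSixSpecialCyclesEllipticPoints
import Literature.Geometry.Kaehler.ComplexTorusQuaternionXSixSpecialCyclesContentCounts
import HarnessLib

/-!
# Primitive special cycles and the Atkin–Lehner group: the short `W`-orbit of `Z(t)` consists of IMPRIMITIVE points,
# so for `t > 0`, `t ∉ {1, 3, 6}`, `W ≅ (ℤ/2ℤ)²` acts freely on the points of `Z_prim(t)` on `X₆` and
# `#(Pt₁(t)/Γ₆) = 4·#(Pt₁(t)/Γ₆⁺)`; for `t ∈ {1, 3, 6}` every orbit is short and `#(Pt₁(t)/Γ₆) = 2·#(Pt₁(t)/Γ₆⁺)`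

[tag: complex_torus] [tag: abelian_surface] [tag: quaternion_multiplication] [tag: complex_multiplication]
[tag: shimura_curve] [tag: special_cycles] [tag: atkin_lehner] [tag: elliptic_points]

Lane `lit-hodgefound`, seat p12, row g37-#5 — THEOREMS ONLY (no definition, no named fact, no instance). Setting as in all
`…XSix…` files (`B = (−1,3)_ℚ`, `𝔬 = ℤ⟨1, i, j, ij⟩`, `O₆`, `Γ₆ = O₆¹`, `ρ`, `Pt(t)`, `Γ₆⁺ = N(O₆)⁺`). A special vector
`x = x₁i + x₂j + x₃ij ∈ L(t)` is PRIMITIVE if `gcd(x₁, x₂, x₃) = 1` (Bézout form `∃ u, u·x = 1`), and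
`Pt₁(t) = {τ ∈ ℌ : ρ(x̂)τ = τ for some primitive x ∈ L(t)}` is the set of points of the primitive part `Z_prim(t)` of the
special cycle (the content-`1` stratum of g36-#5 `…XSixSpecialCyclesContentCounts`: `Z(t) = Σ_{c² ∣ t} Z_prim(t/c²)`).
g37-#2 `…XSixSpecialPointsFibres` proved that a fibre of `Pt(t)/Γ₆ → Pt(t)/Γ₆⁺` (a `W`-orbit of points of `Z(t)` on
`X₆`) has `2` classes iff it consists of `Z(1)`-, `Z(3)`- or `Z(6)`-points and `4` otherwise.

## The mechanism (the print)

At a CM point the special vectors form a line (KRY Prop. 3.4.1), so a point of `Z(t) ∩ Z(t₀)` (`t₀ ∈ {1, 3, 6}`,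
`t = m²t₀` by (3.4.6) «`4t = n²d`») carries the norm-`t` vectors `±m·y`, `y ∈ L(t₀)` primitive: their content is `m`,
and they are primitive only when `t = t₀`. Hence for `t ∉ {1, 3, 6}` the primitive points of `Z(t)` avoid the elliptic
points of `X₆⁺` and `W` acts freely on them (Remark 3.4.7 «permutes the components transitively»), while the short orbit
of `…XSixSpecialPointsFibres` lies in the stratum `m·Z_prim(t₀)`. Conjugation by `N(O₆)` preserves the content
(Vignéras I §4: «`C(h, B)` est stable pour l'opération à gauche de `G̃`»), so the fibres of
`Pt₁(t)/Γ₆ → Pt₁(t)/Γ₆⁺` are the fibres of `Pt(t)/Γ₆ → Pt(t)/Γ₆⁺` through primitive points.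

* S. Kudla, M. Rapoport, T. Yang (2006), §3.4: Prop. 3.4.1, (3.4.6), (3.4.11)–(3.4.13), Remark 3.4.7. [cite: KudlaRapoportYang2006, §3.4]
* A. P. Ogg (1983), §2 pp. 283–284, (2)–(4). [cite: Ogg1983RealPoints, §2]
* P. Bayer, A. Travesa (2007), §2, §7 Table 9. [cite: BayerTravesa2007, §2 and §7]
* M.-F. Vignéras (1980), Ch. I §4 p. 26, Ch. IV §3 B. [cite: VignerasLNM800, Ch. I §4 and Ch. IV §3 B]

## What is proved

* §1 **`eq_of_primitive_of_mem`** (a point carried by a primitive vector of norm `t` and lying on `Pt(t₀)`,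
  `t₀ ∈ {1, 3, 6}`, has `t = t₀`), **`specialPoint_of_primitive`** (`Pt₁(t) ⊆ Pt(t)`).
* §2 **`card_fibre_eq_four_of_primitive`** (`t ∉ {1, 3, 6}`: the fibre of `X₆ → X₆⁺` through a primitive point of `Z(t)`
  has four classes), **`not_plusElliptic_of_primitive`** (such a point is not elliptic on `X₆⁺`).
* §3 **`primitiveSpecialPointsPlus_rel_of_rel`**, **`primitiveSpecialPoints_equivalence`**,
  **`primitiveSpecialPointsPlus_equivalence`**, **`finite_primitive_specialPoints`**,
  **`finite_primitive_specialPointsPlus`**, **`card_primitive_fibre_eq_card_fibre`** (transfer: the fibre of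
  `Pt₁(t)/Γ₆ → Pt₁(t)/Γ₆⁺` over a class has as many classes as the fibre of `Pt(t)/Γ₆ → Pt(t)/Γ₆⁺` over its image —
  `Γ₆⁺` preserves the content), **`card_primitive_fibre_eq_four`** (every fibre, `t > 0`, `t ∉ {1, 3, 6}`),
  **`card_primitive_fibre_eq_two`** (every fibre, `t ∈ {1, 3, 6}`).
* §4 **`card_primitive_specialPoints_eq_four_mul`** (`#(Pt₁(t)/Γ₆) = 4·#(Pt₁(t)/Γ₆⁺)` for `t > 0`, `t ∉ {1, 3, 6}`;
  e.g. `t = 25, 75`: `4 = 4·1`, the values `card_primitive_specialPoints_{twentyfive,seventyfive}`,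
  `card_primitive_specialPointsPlus_{twentyfive,seventyfive}` of g36-#5), **`card_primitive_specialPoints_eq_two_mul`**
  (`t ∈ {1, 3, 6}`: `= 2·`), **`four_dvd_card_primitive_specialPoints`**.
* §5 the imprimitive short orbit: **`special_eq_smul_or_eq_neg_smul_of_mem`** (on `Z(m²t₀) ∩ Z(t₀)` the norm-`m²t₀`
  vectors are `±m·y`), **`dvd_coords_of_mem_sq_mul`** (their coordinates are divisible by `m`: the short `W`-orbit lies
  in the content-`m` stratum `m·Z_prim(t₀)`), **`not_primitive_of_mem_sq_mul`** (`|m| ≥ 2`: they are imprimitive).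

## Honest scope

Statements about the bare quotient TYPES of the `…XSix…` files (`Pt₁(t)` in the Bézout form of
`…XSixSpecialCyclesContentCounts`); the vectors side `|L_prim(t)/O₆^×| = 4·|L_prim(t)/N(O₆)|` is not restated (no
points-to-vectors dictionary for the primitive stratum is in the tree yet). 0 definitions, 0 named facts, 0 instances.
-/

noncomputable section

set_option maxSynthPendingDepth 3

open Quaternion Function

namespace Literature.Geometry.Kaehler.ComplexTorus.QuaternionType

/-! ## §0 Helpers -/

section Helpers

/-- The pure vector of an integer triple lies in `𝔬`. [folklore] -/
private theorem pureVec_mem_order₂₀ (x : ℤ × ℤ × ℤ) : (⟨0, x.1, x.2.1, x.2.2⟩ : ℍ[ℚ,((-1 : ℤ) : ℚ),((3 : ℤ) : ℚ)]) ∈ order (-1) 3 :=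
  ⟨![0, x.1, x.2.1, x.2.2], by ext <;> simp [ofCoords]⟩

/-- Bézout triple ⟹ Bézout function on `Fin 3`. [folklore] -/
private theorem prim_fin₂₀ {x : ℤ × ℤ × ℤ} (h : ∃ u : ℤ × ℤ × ℤ, u.1 * x.1 + u.2.1 * x.2.1 + u.2.2 * x.2.2 = 1) :
    ∃ w : Fin 3 → ℤ, ∑ k, w k * (![x.1, x.2.1, x.2.2] : Fin 3 → ℤ) k = 1 := by
  obtain ⟨u, hu⟩ := h
  exact ⟨![u.1, u.2.1, u.2.2], by simpa [Fin.sum_univ_three] using hu⟩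

/-- The `Fin 3` pure vector of a triple is its pure vector. [folklore] -/
private theorem fin_pureVec₂₀ (x : ℤ × ℤ × ℤ) :
    (⟨0, ((![x.1, x.2.1, x.2.2] : Fin 3 → ℤ) 0 : ℚ), ((![x.1, x.2.1, x.2.2] : Fin 3 → ℤ) 1 : ℚ),
      ((![x.1, x.2.1, x.2.2] : Fin 3 → ℤ) 2 : ℚ)⟩ : ℍ[ℚ,((-1 : ℤ) : ℚ),((3 : ℤ) : ℚ)]) = ⟨0, x.1, x.2.1, x.2.2⟩ := rfl

/-- **The content is an `N(O₆)`-invariant** (left form of `content_eq_of_normaliser_conj`, through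
`unitMulAtkinLehner_conj_content_iff`): `g ≠ 0`, `gO₆ ⊆ O₆g`, `g·(c·p̂) = (c'·p̂')·g`, `p̂, p̂'` primitive, `c ≥ 1` ⟹
`c = c'`. [cite: VignerasLNM800, Ch. I §4 p. 26] [cite: KudlaRapoportYang2006, §3.4 (3.4.6)] -/
private theorem content_eq_of_conj₂₀ {g : ℍ[ℚ,((-1 : ℤ) : ℚ),((3 : ℤ) : ℚ)]} (hg0 : g ≠ 0)
    (hN : (∀ a : ℍ[ℚ,((-1 : ℤ) : ℚ),((3 : ℤ) : ℚ)], (a ∈ order (-1) 3 ∨ a - ⟨1/2, 1/2, 1/2, -1/2⟩ ∈ order (-1) 3) →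
          ∃ b : ℍ[ℚ,((-1 : ℤ) : ℚ),((3 : ℤ) : ℚ)], (b ∈ order (-1) 3 ∨ b - ⟨1/2, 1/2, 1/2, -1/2⟩ ∈ order (-1) 3) ∧ g * a = b * g))
    {c c' : ℕ} (hc : 0 < c) {x : ℤ × ℤ × ℤ} {x' : Fin 3 → ℤ}
    (hx : ∃ u : ℤ × ℤ × ℤ, u.1 * x.1 + u.2.1 * x.2.1 + u.2.2 * x.2.2 = 1)
    (hx' : ∃ u : Fin 3 → ℤ, ∑ k, u k * x' k = 1)
    (h : g * ((c : ℚ) • (⟨0, x.1, x.2.1, x.2.2⟩ : ℍ[ℚ,((-1 : ℤ) : ℚ),((3 : ℤ) : ℚ)])) = ((c' : ℚ) • (⟨0, x' 0, x' 1, x' 2⟩ : ℍ[ℚ,((-1 : ℤ) : ℚ),((3 : ℤ) : ℚ)])) * g) :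
    c = c' := by
  obtain ⟨q, v, k, l, hq, hv, h1, -, -, rfl⟩ := (normalises_maxOrder_iff_exists' hg0).1 hN
  rw [smul_mul_assoc q, mul_smul_comm q] at h
  have h' := smul_right_injective ℍ[ℚ,((-1 : ℤ) : ℚ),((3 : ℤ) : ℚ)] hq.ne' h
  have e := (unitMulAtkinLehner_conj_content_iff (c' := c') (p' := x') hv h1 k l hc (prim_fin₂₀ hx) hx').1
  rw [fin_pureVec₂₀] at e
  exact (e h').1

/-- **All fibres of size `k`**: `|Q| = k·|Q'|` for a map between finite types whose fibres all have `k` elements.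
[folklore] -/
private theorem card_eq_mul_of_card_fibre₂₀ {Q Q' : Type*} [Finite Q] [Finite Q'] (f : Q → Q') (k : ℕ)
    (h : ∀ c, Nat.card {a // f a = c} = k) : Nat.card Q = k * Nat.card Q' := by
  classical
  letI := Fintype.ofFinite Q'
  rw [← Nat.card_congr (Equiv.sigmaFiberEquiv f), Nat.card_sigma]
  simp_rw [h]
  rw [Finset.sum_const, smul_eq_mul, Finset.card_univ, ← Nat.card_eq_fintype_card, mul_comm]

end Helpers

/-! ## §1 A primitive point on `Z(1) ∪ Z(3) ∪ Z(6)` has `t ∈ {1, 3, 6}` -/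

section Primitive

/-- **A PRIMITIVE VECTOR AT A `Z(t₀)`-POINT HAS NORM `t₀`** (`t₀ ∈ {1, 3, 6}`): if `τ ∉ ℝ` is fixed by a primitive
`x ∈ L(t)` and by some `y ∈ L(t₀)`, then `t = t₀` — `x̂ = c·ŷ` (two special vectors at one CM point are proportional),
`c·(u·y) = u·x = 1` by Bézout, so `c = 1/n` with `n ∈ ℤ` and `n²t = t₀ ∈ {1, 3, 6}` forces `n² = 1`. So the short
`W`-orbit of `Z(m²t₀)`, `m ≥ 2`, consists of points of content `m`. [cite: KudlaRapoportYang2006, §3.4 Prop. 3.4.1 and (3.4.6) («`4t = n²d`»)] [cite: Ogg1983RealPoints, §2 (4)] -/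
theorem eq_of_primitive_of_mem {t t₀ : ℤ} (ht₀ : t₀ = 1 ∨ t₀ = 3 ∨ t₀ = 6) {τ : ℂ} (hτ : τ.im ≠ 0)
    {x : ℤ × ℤ × ℤ} (hprim : ∃ u : ℤ × ℤ × ℤ, u.1 * x.1 + u.2.1 * x.2.1 + u.2.2 * x.2.2 = 1)
    (hQ : x.1 ^ 2 - 3 * x.2.1 ^ 2 - 3 * x.2.2 ^ 2 = t)
    (hfix : moebius (rho (-1) 3 (by norm_num) (castQ (-1) 3 (⟨0, x.1, x.2.1, x.2.2⟩ : ℍ[ℚ,((-1 : ℤ) : ℚ),((3 : ℤ) : ℚ)]))) τ = τ)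
    (hmem : ∃ x : ℍ[ℚ,((-1 : ℤ) : ℚ),((3 : ℤ) : ℚ)], x ∈ order (-1) 3 ∧ x.re = 0 ∧ (x * star x).re = t₀ ∧
        moebius (rho (-1) 3 (by norm_num) (castQ (-1) 3 x)) τ = τ) :
    t = t₀ := by
  obtain ⟨y, hy, hyre, hyn, hfy⟩ := hmem
  obtain ⟨p, hpe, hpQ⟩ := exists_eq_mk_of_mem_order_re_zero hy hyre
  have ht0pos : (0 : ℤ) < t₀ := by rcases ht₀ with rfl | rfl | rfl <;> norm_num
  have hy0 : y ≠ 0 := by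
    intro h0
    rw [h0, zero_mul, QuaternionAlgebra.re_zero] at hyn
    have : (0 : ℚ) < t₀ := by exact_mod_cast ht0pos
    rw [← hyn] at this
    exact lt_irrefl _ this
  have hxre : ((⟨0, x.1, x.2.1, x.2.2⟩ : ℍ[ℚ,((-1 : ℤ) : ℚ),((3 : ℤ) : ℚ)])).re = 0 := rfl
  obtain ⟨c, hc⟩ := exists_eq_smul_of_moebius_eq (a := -1) (b := 3) (by norm_num) (by norm_num) hyre hy0 hxre hτ hfy hfix
  -- norms: `t = c²·t₀`
  have hnorm : (t : ℚ) = c ^ 2 * t₀ := by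
    have hx : (((⟨0, x.1, x.2.1, x.2.2⟩ : ℍ[ℚ,((-1 : ℤ) : ℚ),((3 : ℤ) : ℚ)])) * star (⟨0, x.1, x.2.1, x.2.2⟩ : ℍ[ℚ,((-1 : ℤ) : ℚ),((3 : ℤ) : ℚ)])).re = (t : ℚ) := by
      rw [pureVec_norm]; exact_mod_cast hQ
    rw [← hx, ← hyn, hc, QuaternionAlgebra.star_smul, smul_mul_smul_comm, QuaternionAlgebra.re_smul, smul_eq_mul, sq]
  -- coordinates: `xᵢ = c·pᵢ`
  rw [hpe, QuaternionAlgebra.smul_mk] at hc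
  simp only [smul_eq_mul, mul_zero, QuaternionAlgebra.mk.injEq, true_and] at hc
  obtain ⟨h1, h2, h3⟩ := hc
  -- Bézout: `c·n = 1`, `n = u·p ∈ ℤ`
  obtain ⟨u, hu⟩ := hprim
  have hcn : c * ((u.1 * p.1 + u.2.1 * p.2.1 + u.2.2 * p.2.2 : ℤ) : ℚ) = 1 := by
    have e := congrArg (Int.cast : ℤ → ℚ) hu
    push_cast at e ⊢
    rw [h1, h2, h3] at e
    linear_combination e
  set n : ℤ := u.1 * p.1 + u.2.1 * p.2.1 + u.2.2 * p.2.2 with hn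
  have key : ((n ^ 2 * t : ℤ) : ℚ) = (t₀ : ℚ) := by
    push_cast
    rw [hnorm]
    have e : (n : ℚ) ^ 2 * (c ^ 2 * (t₀ : ℚ)) = (c * (n : ℚ)) ^ 2 * (t₀ : ℚ) := by ring
    rw [e, hcn, one_pow, one_mul]
  have key' : n ^ 2 * t = t₀ := by exact_mod_cast key
  have htpos : 0 < t := by nlinarith [sq_nonneg n, key', ht0pos]
  have hle : n ^ 2 ≤ 6 := by rcases ht₀ with rfl | rfl | rfl <;> nlinarith [sq_nonneg n]
  have hl : -2 ≤ n := by nlinarith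
  have hr : n ≤ 2 := by nlinarith
  interval_cases n <;> rcases ht₀ with rfl | rfl | rfl <;> omega

/-- **`Pt₁(t) ⊆ Pt(t)`**: a point carried by a primitive `x ∈ L(t)` is a point of `Z(t)` (`x̂ ∈ 𝔬`, `tr x̂ = 0`,
`nr x̂ = Q(x) = t`). [cite: KudlaRapoportYang2006, §3.4 (3.4.6) and (3.4.9)] -/
theorem specialPoint_of_primitive {t : ℤ} {τ : ℂ}
    (h : ∃ x : ℤ × ℤ × ℤ, (∃ u : ℤ × ℤ × ℤ, u.1 * x.1 + u.2.1 * x.2.1 + u.2.2 * x.2.2 = 1) ∧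
        x.1 ^ 2 - 3 * x.2.1 ^ 2 - 3 * x.2.2 ^ 2 = t ∧
        moebius (rho (-1) 3 (by norm_num) (castQ (-1) 3 (⟨0, x.1, x.2.1, x.2.2⟩ : ℍ[ℚ,((-1 : ℤ) : ℚ),((3 : ℤ) : ℚ)]))) τ = τ) :
    ∃ x : ℍ[ℚ,((-1 : ℤ) : ℚ),((3 : ℤ) : ℚ)], x ∈ order (-1) 3 ∧ x.re = 0 ∧ (x * star x).re = t ∧
        moebius (rho (-1) 3 (by norm_num) (castQ (-1) 3 x)) τ = τ := by
  obtain ⟨x, -, hQ, hfix⟩ := h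
  exact ⟨(⟨0, x.1, x.2.1, x.2.2⟩ : ℍ[ℚ,((-1 : ℤ) : ℚ),((3 : ℤ) : ℚ)]), pureVec_mem_order₂₀ x, rfl, by rw [pureVec_norm]; exact_mod_cast hQ, hfix⟩

end Primitive

/-! ## §2 Primitive points of `Z(t)`, `t ∉ {1, 3, 6}`, lie in full `W`-orbits -/

section Orbits

/-- **THE FIBRE OF `X₆ → X₆⁺` THROUGH A PRIMITIVE POINT OF `Z(t)`, `t ∉ {1, 3, 6}`, HAS FOUR CLASSES** — such a point is
on none of `Z(1)`, `Z(3)`, `Z(6)` (§1), so `W ≅ (ℤ/2ℤ)²` acts freely on its orbit (`card_fibre_eq_four_of_not_mem`).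
[cite: KudlaRapoportYang2006, §3.4 Remark 3.4.7 and (3.4.6)] [cite: Ogg1983RealPoints, §2 (2)–(4)] [cite: BayerTravesa2007, §2] -/
theorem card_fibre_eq_four_of_primitive {t : ℤ} (h136 : t ≠ 1 ∧ t ≠ 3 ∧ t ≠ 6) (p : {τ : ℂ // 0 < τ.im ∧ ∃ x : ℍ[ℚ,((-1 : ℤ) : ℚ),((3 : ℤ) : ℚ)],
        x ∈ order (-1) 3 ∧ x.re = 0 ∧ (x * star x).re = t ∧ moebius (rho (-1) 3 (by norm_num) (castQ (-1) 3 x)) τ = τ})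
    (hp : ∃ x : ℤ × ℤ × ℤ, (∃ u : ℤ × ℤ × ℤ, u.1 * x.1 + u.2.1 * x.2.1 + u.2.2 * x.2.2 = 1) ∧
        x.1 ^ 2 - 3 * x.2.1 ^ 2 - 3 * x.2.2 ^ 2 = t ∧
        moebius (rho (-1) 3 (by norm_num) (castQ (-1) 3 (⟨0, x.1, x.2.1, x.2.2⟩ : ℍ[ℚ,((-1 : ℤ) : ℚ),((3 : ℤ) : ℚ)]))) p.1 = p.1) :
    Nat.card {a : Quot (fun p q : {τ : ℂ // 0 < τ.im ∧ ∃ x : ℍ[ℚ,((-1 : ℤ) : ℚ),((3 : ℤ) : ℚ)],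
        x ∈ order (-1) 3 ∧ x.re = 0 ∧ (x * star x).re = t ∧ moebius (rho (-1) 3 (by norm_num) (castQ (-1) 3 x)) τ = τ} ↦
      ∃ v : ℍ[ℚ,((-1 : ℤ) : ℚ),((3 : ℤ) : ℚ)], (v ∈ order (-1) 3 ∨ v - ⟨1/2, 1/2, 1/2, -1/2⟩ ∈ order (-1) 3) ∧
        v * star v = 1 ∧ moebius (rho (-1) 3 (by norm_num) (castQ (-1) 3 v)) p.1 = q.1) //
      Quot.factor
      (fun p q : {τ : ℂ // 0 < τ.im ∧ ∃ x : ℍ[ℚ,((-1 : ℤ) : ℚ),((3 : ℤ) : ℚ)],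
        x ∈ order (-1) 3 ∧ x.re = 0 ∧ (x * star x).re = t ∧ moebius (rho (-1) 3 (by norm_num) (castQ (-1) 3 x)) τ = τ} ↦
        ∃ v : ℍ[ℚ,((-1 : ℤ) : ℚ),((3 : ℤ) : ℚ)], (v ∈ order (-1) 3 ∨ v - ⟨1/2, 1/2, 1/2, -1/2⟩ ∈ order (-1) 3) ∧
        v * star v = 1 ∧ moebius (rho (-1) 3 (by norm_num) (castQ (-1) 3 v)) p.1 = q.1)
      (fun p q : {τ : ℂ // 0 < τ.im ∧ ∃ x : ℍ[ℚ,((-1 : ℤ) : ℚ),((3 : ℤ) : ℚ)],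
        x ∈ order (-1) 3 ∧ x.re = 0 ∧ (x * star x).re = t ∧ moebius (rho (-1) 3 (by norm_num) (castQ (-1) 3 x)) τ = τ} ↦
        ∃ g : ℍ[ℚ,((-1 : ℤ) : ℚ),((3 : ℤ) : ℚ)], g ≠ 0 ∧
        (∀ a : ℍ[ℚ,((-1 : ℤ) : ℚ),((3 : ℤ) : ℚ)], (a ∈ order (-1) 3 ∨ a - ⟨1/2, 1/2, 1/2, -1/2⟩ ∈ order (-1) 3) →
          ∃ b : ℍ[ℚ,((-1 : ℤ) : ℚ),((3 : ℤ) : ℚ)], (b ∈ order (-1) 3 ∨ b - ⟨1/2, 1/2, 1/2, -1/2⟩ ∈ order (-1) 3) ∧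
            g * a = b * g) ∧
        0 < (g * star g).re ∧ moebius (rho (-1) 3 (by norm_num) (castQ (-1) 3 g)) p.1 = q.1)
      (specialPointsPlus_rel_of_specialPoints_rel t) a = Quot.mk _ p} = 4 := by
  obtain ⟨x, hprim, hQ, hfix⟩ := hp
  refine card_fibre_eq_four_of_not_mem p (fun h ↦ h136.1 ?_) (fun h ↦ h136.2.1 ?_) (fun h ↦ h136.2.2 ?_)
  · exact eq_of_primitive_of_mem (t₀ := 1) (Or.inl rfl) p.2.1.ne' hprim hQ hfix (by push_cast; exact h)
  · exact eq_of_primitive_of_mem (t₀ := 3) (Or.inr (Or.inl rfl)) p.2.1.ne' hprim hQ hfix (by push_cast; exact h)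
  · exact eq_of_primitive_of_mem (t₀ := 6) (Or.inr (Or.inr rfl)) p.2.1.ne' hprim hQ hfix (by push_cast; exact h)

/-- **A PRIMITIVE POINT OF `Z(t)`, `t ∉ {1, 3, 6}`, IS NOT AN ELLIPTIC POINT OF `X₆⁺`**: no non-scalar element of `Γ₆⁺`
fixes it (`plusElliptic_iff_mem_one_three_six`). [cite: Ogg1983RealPoints, §2 p. 284 and (4)] [cite: BayerTravesa2007, §7 Table 9] [cite: KudlaRapoportYang2006, §3.4 (3.4.6)] -/
theorem not_plusElliptic_of_primitive {t : ℤ} (h136 : t ≠ 1 ∧ t ≠ 3 ∧ t ≠ 6) (p : {τ : ℂ // 0 < τ.im ∧ ∃ x : ℍ[ℚ,((-1 : ℤ) : ℚ),((3 : ℤ) : ℚ)],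
        x ∈ order (-1) 3 ∧ x.re = 0 ∧ (x * star x).re = t ∧ moebius (rho (-1) 3 (by norm_num) (castQ (-1) 3 x)) τ = τ})
    (hp : ∃ x : ℤ × ℤ × ℤ, (∃ u : ℤ × ℤ × ℤ, u.1 * x.1 + u.2.1 * x.2.1 + u.2.2 * x.2.2 = 1) ∧
        x.1 ^ 2 - 3 * x.2.1 ^ 2 - 3 * x.2.2 ^ 2 = t ∧
        moebius (rho (-1) 3 (by norm_num) (castQ (-1) 3 (⟨0, x.1, x.2.1, x.2.2⟩ : ℍ[ℚ,((-1 : ℤ) : ℚ),((3 : ℤ) : ℚ)]))) p.1 = p.1) :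
    ¬ (∃ g : ℍ[ℚ,((-1 : ℤ) : ℚ),((3 : ℤ) : ℚ)], g ≠ 0 ∧
        (∀ a : ℍ[ℚ,((-1 : ℤ) : ℚ),((3 : ℤ) : ℚ)], (a ∈ order (-1) 3 ∨ a - ⟨1/2, 1/2, 1/2, -1/2⟩ ∈ order (-1) 3) →
          ∃ b : ℍ[ℚ,((-1 : ℤ) : ℚ),((3 : ℤ) : ℚ)], (b ∈ order (-1) 3 ∨ b - ⟨1/2, 1/2, 1/2, -1/2⟩ ∈ order (-1) 3) ∧ g * a = b * g) ∧
        0 < (g * star g).re ∧ (∀ q : ℚ, g ≠ (q : ℍ[ℚ,((-1 : ℤ) : ℚ),((3 : ℤ) : ℚ)])) ∧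
        moebius (rho (-1) 3 (by norm_num) (castQ (-1) 3 g)) p.1 = p.1) := by
  rw [← card_fibre_eq_four_iff_not_plusElliptic p]
  exact card_fibre_eq_four_of_primitive h136 p hp

end Orbits

/-! ## §3 The quotients `Pt₁(t)/Γ₆ → Pt₁(t)/Γ₆⁺` and the transfer of fibres -/

section Transfer

/-- **`Γ₆`-equivalent primitive points are `Γ₆⁺`-equivalent** (`Γ₆ ⊂ Γ₆⁺`); the projection
`Pt₁(t)/Γ₆ → Pt₁(t)/Γ₆⁺` is `Quot.factor` along this implication. [cite: BayerTravesa2007, §2] [cite: VignerasLNM800, Ch. IV §3 B] -/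
theorem primitiveSpecialPointsPlus_rel_of_rel (t : ℤ) :
    ∀ p q : {τ : ℂ // 0 < τ.im ∧ ∃ x : ℤ × ℤ × ℤ, (∃ u : ℤ × ℤ × ℤ, u.1 * x.1 + u.2.1 * x.2.1 + u.2.2 * x.2.2 = 1) ∧
        x.1 ^ 2 - 3 * x.2.1 ^ 2 - 3 * x.2.2 ^ 2 = t ∧
        moebius (rho (-1) 3 (by norm_num) (castQ (-1) 3 (⟨0, x.1, x.2.1, x.2.2⟩ : ℍ[ℚ,((-1 : ℤ) : ℚ),((3 : ℤ) : ℚ)]))) τ = τ},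
      (∃ v : ℍ[ℚ,((-1 : ℤ) : ℚ),((3 : ℤ) : ℚ)], (v ∈ order (-1) 3 ∨ v - ⟨1/2, 1/2, 1/2, -1/2⟩ ∈ order (-1) 3) ∧
        v * star v = 1 ∧ moebius (rho (-1) 3 (by norm_num) (castQ (-1) 3 v)) p.1 = q.1) →
      ∃ g : ℍ[ℚ,((-1 : ℤ) : ℚ),((3 : ℤ) : ℚ)], g ≠ 0 ∧
        (∀ a : ℍ[ℚ,((-1 : ℤ) : ℚ),((3 : ℤ) : ℚ)], (a ∈ order (-1) 3 ∨ a - ⟨1/2, 1/2, 1/2, -1/2⟩ ∈ order (-1) 3) →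
          ∃ b : ℍ[ℚ,((-1 : ℤ) : ℚ),((3 : ℤ) : ℚ)], (b ∈ order (-1) 3 ∨ b - ⟨1/2, 1/2, 1/2, -1/2⟩ ∈ order (-1) 3) ∧
            g * a = b * g) ∧
        0 < (g * star g).re ∧ moebius (rho (-1) 3 (by norm_num) (castQ (-1) 3 g)) p.1 = q.1 := by
  rintro p q ⟨v, hv, hv1, h⟩
  have hvn : (v * star v).re = 1 := by rw [hv1, QuaternionAlgebra.re_one]
  refine ⟨v, fun h0 ↦ by rw [h0, zero_mul, QuaternionAlgebra.re_zero] at hvn; exact zero_ne_one hvn,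
    (normalises_of_eq_smul_unit_mul_atkinLehner (g := v) (q := 1) hv (Or.inl hv1) 0 0
      (by rw [pow_zero, pow_zero, mul_one, mul_one, one_smul])).2.1, by rw [hvn]; exact one_pos, h⟩

/-- **`Γ₆`-EQUIVALENCE IS AN EQUIVALENCE RELATION on `Pt₁(t)`** (read on the complex numbers only, as on `Pt(t)`).
[cite: KudlaRapoportYang2006, §3.4 (3.4.11)] -/
theorem primitiveSpecialPoints_equivalence (t : ℤ) :
    Equivalence (fun p q : {τ : ℂ // 0 < τ.im ∧ ∃ x : ℤ × ℤ × ℤ, (∃ u : ℤ × ℤ × ℤ, u.1 * x.1 + u.2.1 * x.2.1 + u.2.2 * x.2.2 = 1) ∧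
        x.1 ^ 2 - 3 * x.2.1 ^ 2 - 3 * x.2.2 ^ 2 = t ∧
        moebius (rho (-1) 3 (by norm_num) (castQ (-1) 3 (⟨0, x.1, x.2.1, x.2.2⟩ : ℍ[ℚ,((-1 : ℤ) : ℚ),((3 : ℤ) : ℚ)]))) τ = τ} ↦
      ∃ v : ℍ[ℚ,((-1 : ℤ) : ℚ),((3 : ℤ) : ℚ)], (v ∈ order (-1) 3 ∨ v - ⟨1/2, 1/2, 1/2, -1/2⟩ ∈ order (-1) 3) ∧
        v * star v = 1 ∧ moebius (rho (-1) 3 (by norm_num) (castQ (-1) 3 v)) p.1 = q.1) := by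
  have hE := specialPoints_equivalence t
  exact ⟨fun p ↦ hE.refl ⟨p.1, p.2.1, specialPoint_of_primitive p.2.2⟩,
    fun {p q} h ↦ hE.symm (x := ⟨p.1, p.2.1, specialPoint_of_primitive p.2.2⟩)
      (y := ⟨q.1, q.2.1, specialPoint_of_primitive q.2.2⟩) h,
    fun {p q r} h h' ↦ hE.trans (x := ⟨p.1, p.2.1, specialPoint_of_primitive p.2.2⟩)
      (y := ⟨q.1, q.2.1, specialPoint_of_primitive q.2.2⟩) (z := ⟨r.1, r.2.1, specialPoint_of_primitive r.2.2⟩) h h'⟩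

/-- **`Γ₆⁺`-EQUIVALENCE IS AN EQUIVALENCE RELATION on `Pt₁(t)`.** [cite: BayerTravesa2007, §2] -/
theorem primitiveSpecialPointsPlus_equivalence (t : ℤ) :
    Equivalence (fun p q : {τ : ℂ // 0 < τ.im ∧ ∃ x : ℤ × ℤ × ℤ, (∃ u : ℤ × ℤ × ℤ, u.1 * x.1 + u.2.1 * x.2.1 + u.2.2 * x.2.2 = 1) ∧
        x.1 ^ 2 - 3 * x.2.1 ^ 2 - 3 * x.2.2 ^ 2 = t ∧
        moebius (rho (-1) 3 (by norm_num) (castQ (-1) 3 (⟨0, x.1, x.2.1, x.2.2⟩ : ℍ[ℚ,((-1 : ℤ) : ℚ),((3 : ℤ) : ℚ)]))) τ = τ} ↦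
      ∃ g : ℍ[ℚ,((-1 : ℤ) : ℚ),((3 : ℤ) : ℚ)], g ≠ 0 ∧
        (∀ a : ℍ[ℚ,((-1 : ℤ) : ℚ),((3 : ℤ) : ℚ)], (a ∈ order (-1) 3 ∨ a - ⟨1/2, 1/2, 1/2, -1/2⟩ ∈ order (-1) 3) →
          ∃ b : ℍ[ℚ,((-1 : ℤ) : ℚ),((3 : ℤ) : ℚ)], (b ∈ order (-1) 3 ∨ b - ⟨1/2, 1/2, 1/2, -1/2⟩ ∈ order (-1) 3) ∧
            g * a = b * g) ∧
        0 < (g * star g).re ∧ moebius (rho (-1) 3 (by norm_num) (castQ (-1) 3 g)) p.1 = q.1) := by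
  have hE := specialPointsPlus_equivalence t
  exact ⟨fun p ↦ hE.refl ⟨p.1, p.2.1, specialPoint_of_primitive p.2.2⟩,
    fun {p q} h ↦ hE.symm (x := ⟨p.1, p.2.1, specialPoint_of_primitive p.2.2⟩)
      (y := ⟨q.1, q.2.1, specialPoint_of_primitive q.2.2⟩) h,
    fun {p q r} h h' ↦ hE.trans (x := ⟨p.1, p.2.1, specialPoint_of_primitive p.2.2⟩)
      (y := ⟨q.1, q.2.1, specialPoint_of_primitive q.2.2⟩) (z := ⟨r.1, r.2.1, specialPoint_of_primitive r.2.2⟩) h h'⟩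

/-- **THE CONTENT IS CONSTANT ALONG `Γ₆⁺`-ORBITS OF POINTS**: if `g ∈ Γ₆⁺` carries a primitive point of `Z(t)` to a point
of `Z(t)` (`t > 0`), the latter is primitive too — `g x̂ = ±ŷ g` (`conj_eq_or_eq_neg_of_moebius_eq_of_norm_pos`) and the
content is `N(O₆)`-invariant. [cite: VignerasLNM800, Ch. I §4 p. 26 («`C(h, B)` est stable pour l'opération à gauche de `G̃`»)] [cite: KudlaRapoportYang2006, §3.4 (3.4.6) and (3.4.11)] -/
theorem primitive_of_specialPointsPlus_rel {t : ℤ} (ht : 0 < t) (p q : {τ : ℂ // 0 < τ.im ∧ ∃ x : ℍ[ℚ,((-1 : ℤ) : ℚ),((3 : ℤ) : ℚ)],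
        x ∈ order (-1) 3 ∧ x.re = 0 ∧ (x * star x).re = t ∧ moebius (rho (-1) 3 (by norm_num) (castQ (-1) 3 x)) τ = τ})
    (hp : ∃ x : ℤ × ℤ × ℤ, (∃ u : ℤ × ℤ × ℤ, u.1 * x.1 + u.2.1 * x.2.1 + u.2.2 * x.2.2 = 1) ∧
        x.1 ^ 2 - 3 * x.2.1 ^ 2 - 3 * x.2.2 ^ 2 = t ∧
        moebius (rho (-1) 3 (by norm_num) (castQ (-1) 3 (⟨0, x.1, x.2.1, x.2.2⟩ : ℍ[ℚ,((-1 : ℤ) : ℚ),((3 : ℤ) : ℚ)]))) p.1 = p.1)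
    (hrel : ∃ g : ℍ[ℚ,((-1 : ℤ) : ℚ),((3 : ℤ) : ℚ)], g ≠ 0 ∧
        (∀ a : ℍ[ℚ,((-1 : ℤ) : ℚ),((3 : ℤ) : ℚ)], (a ∈ order (-1) 3 ∨ a - ⟨1/2, 1/2, 1/2, -1/2⟩ ∈ order (-1) 3) →
          ∃ b : ℍ[ℚ,((-1 : ℤ) : ℚ),((3 : ℤ) : ℚ)], (b ∈ order (-1) 3 ∨ b - ⟨1/2, 1/2, 1/2, -1/2⟩ ∈ order (-1) 3) ∧
            g * a = b * g) ∧
        0 < (g * star g).re ∧ moebius (rho (-1) 3 (by norm_num) (castQ (-1) 3 g)) p.1 = q.1) :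
    ∃ x : ℤ × ℤ × ℤ, (∃ u : ℤ × ℤ × ℤ, u.1 * x.1 + u.2.1 * x.2.1 + u.2.2 * x.2.2 = 1) ∧
        x.1 ^ 2 - 3 * x.2.1 ^ 2 - 3 * x.2.2 ^ 2 = t ∧
        moebius (rho (-1) 3 (by norm_num) (castQ (-1) 3 (⟨0, x.1, x.2.1, x.2.2⟩ : ℍ[ℚ,((-1 : ℤ) : ℚ),((3 : ℤ) : ℚ)]))) q.1 = q.1 := by
  obtain ⟨x, hprim, hQ, hfx⟩ := hp
  obtain ⟨g, hg0, hL, hgn, hg⟩ := hrel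
  obtain ⟨y, hy, hyre, hyn, hfy⟩ := q.2.2
  have h3 : (0 : ℤ) < 3 := by norm_num
  have hxn : (((⟨0, x.1, x.2.1, x.2.2⟩ : ℍ[ℚ,((-1 : ℤ) : ℚ),((3 : ℤ) : ℚ)])) * star (⟨0, x.1, x.2.1, x.2.2⟩ : ℍ[ℚ,((-1 : ℤ) : ℚ),((3 : ℤ) : ℚ)])).re = (t : ℚ) := by rw [pureVec_norm]; exact_mod_cast hQ
  have htq : (0 : ℚ) < t := by exact_mod_cast ht
  -- `g x̂ = ± ŷ g`; replace `y` by the sign-corrected vector `w`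
  have hw : ∃ w : ℍ[ℚ,((-1 : ℤ) : ℚ),((3 : ℤ) : ℚ)], w ∈ order (-1) 3 ∧ w.re = 0 ∧ (w * star w).re = t ∧
      moebius (rho (-1) 3 (by norm_num) (castQ (-1) 3 w)) q.1 = q.1 ∧ g * (⟨0, x.1, x.2.1, x.2.2⟩ : ℍ[ℚ,((-1 : ℤ) : ℚ),((3 : ℤ) : ℚ)]) = w * g := by
    rcases conj_eq_or_eq_neg_of_moebius_eq_of_norm_pos hgn rfl hyre (by rw [hxn, hyn]) (by rw [hyn]; exact htq)
        p.2.1.ne' q.2.1.ne' hfx hfy hg with e | e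
    · exact ⟨y, hy, hyre, hyn, hfy, e⟩
    · refine ⟨-y, neg_mem hy, by rw [QuaternionAlgebra.re_neg, hyre, neg_zero],
        by rw [star_neg, neg_mul_neg]; exact hyn, ?_, e⟩
      rw [show -y = (-1 : ℚ) • y from (_root_.neg_one_smul ℚ y).symm, moebius_rho_castQ_smul (by norm_num : (-1 : ℚ) ≠ 0)]
      exact hfy
  obtain ⟨w, hwO, hwre, hwn, hfw, e⟩ := hw
  -- content decomposition of `w` and invariance: content `1`
  obtain ⟨c, p', hc, hp', hwe, hQ'⟩ := special_eq_content_smul_primitive_norm hwO hwre hwn ht.ne'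
  rw [hwe, ← one_smul ℚ (⟨0, x.1, x.2.1, x.2.2⟩ : ℍ[ℚ,((-1 : ℤ) : ℚ),((3 : ℤ) : ℚ)])] at e
  have h1c : 1 = c := content_eq_of_conj₂₀ hg0 hL one_pos hprim hp' (by exact_mod_cast e)
  subst h1c
  refine ⟨(p' 0, p' 1, p' 2), ?_, by simpa using hQ', ?_⟩
  · obtain ⟨u, hu⟩ := hp'
    exact ⟨(u 0, u 1, u 2), by simpa [Fin.sum_univ_three] using hu⟩
  · have : w = (⟨0, p' 0, p' 1, p' 2⟩ : ℍ[ℚ,((-1 : ℤ) : ℚ),((3 : ℤ) : ℚ)]) := by rw [hwe, Nat.cast_one, one_smul]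
    rw [← this]
    exact hfw

/-- **`Pt₁(t)/Γ₆` IS FINITE** (`t > 0`): it injects into `Pt(t)/Γ₆`. [cite: KudlaRapoportYang2006, §3.4 Lemma 3.4.3 and (3.4.11)] -/
theorem finite_primitive_specialPoints {t : ℤ} (ht : 0 < t) :
    Finite (Quot (fun p q : {τ : ℂ // 0 < τ.im ∧ ∃ x : ℤ × ℤ × ℤ, (∃ u : ℤ × ℤ × ℤ, u.1 * x.1 + u.2.1 * x.2.1 + u.2.2 * x.2.2 = 1) ∧
        x.1 ^ 2 - 3 * x.2.1 ^ 2 - 3 * x.2.2 ^ 2 = t ∧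
        moebius (rho (-1) 3 (by norm_num) (castQ (-1) 3 (⟨0, x.1, x.2.1, x.2.2⟩ : ℍ[ℚ,((-1 : ℤ) : ℚ),((3 : ℤ) : ℚ)]))) τ = τ} ↦
      ∃ v : ℍ[ℚ,((-1 : ℤ) : ℚ),((3 : ℤ) : ℚ)], (v ∈ order (-1) 3 ∨ v - ⟨1/2, 1/2, 1/2, -1/2⟩ ∈ order (-1) 3) ∧
        v * star v = 1 ∧ moebius (rho (-1) 3 (by norm_num) (castQ (-1) 3 v)) p.1 = q.1)) := by
  set S : {τ : ℂ // 0 < τ.im ∧ ∃ x : ℍ[ℚ,((-1 : ℤ) : ℚ),((3 : ℤ) : ℚ)],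
        x ∈ order (-1) 3 ∧ x.re = 0 ∧ (x * star x).re = t ∧ moebius (rho (-1) 3 (by norm_num) (castQ (-1) 3 x)) τ = τ} →
      {τ : ℂ // 0 < τ.im ∧ ∃ x : ℍ[ℚ,((-1 : ℤ) : ℚ),((3 : ℤ) : ℚ)],
        x ∈ order (-1) 3 ∧ x.re = 0 ∧ (x * star x).re = t ∧ moebius (rho (-1) 3 (by norm_num) (castQ (-1) 3 x)) τ = τ} → Prop :=
    fun p q ↦ ∃ v : ℍ[ℚ,((-1 : ℤ) : ℚ),((3 : ℤ) : ℚ)], (v ∈ order (-1) 3 ∨ v - ⟨1/2, 1/2, 1/2, -1/2⟩ ∈ order (-1) 3) ∧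
        v * star v = 1 ∧ moebius (rho (-1) 3 (by norm_num) (castQ (-1) 3 v)) p.1 = q.1 with hS
  set SP : {τ : ℂ // 0 < τ.im ∧ ∃ x : ℤ × ℤ × ℤ, (∃ u : ℤ × ℤ × ℤ, u.1 * x.1 + u.2.1 * x.2.1 + u.2.2 * x.2.2 = 1) ∧
        x.1 ^ 2 - 3 * x.2.1 ^ 2 - 3 * x.2.2 ^ 2 = t ∧
        moebius (rho (-1) 3 (by norm_num) (castQ (-1) 3 (⟨0, x.1, x.2.1, x.2.2⟩ : ℍ[ℚ,((-1 : ℤ) : ℚ),((3 : ℤ) : ℚ)]))) τ = τ} →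
      {τ : ℂ // 0 < τ.im ∧ ∃ x : ℤ × ℤ × ℤ, (∃ u : ℤ × ℤ × ℤ, u.1 * x.1 + u.2.1 * x.2.1 + u.2.2 * x.2.2 = 1) ∧
        x.1 ^ 2 - 3 * x.2.1 ^ 2 - 3 * x.2.2 ^ 2 = t ∧
        moebius (rho (-1) 3 (by norm_num) (castQ (-1) 3 (⟨0, x.1, x.2.1, x.2.2⟩ : ℍ[ℚ,((-1 : ℤ) : ℚ),((3 : ℤ) : ℚ)]))) τ = τ} → Prop :=
    fun p q ↦ ∃ v : ℍ[ℚ,((-1 : ℤ) : ℚ),((3 : ℤ) : ℚ)], (v ∈ order (-1) 3 ∨ v - ⟨1/2, 1/2, 1/2, -1/2⟩ ∈ order (-1) 3) ∧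
        v * star v = 1 ∧ moebius (rho (-1) 3 (by norm_num) (castQ (-1) 3 v)) p.1 = q.1 with hSP
  haveI : Finite (Quot S) := finite_specialPoints ht
  have hiff : ∀ a b, Quot.mk S a = Quot.mk S b ↔ S a b := specialPoints_mk_eq_iff t
  have hiffP : ∀ a b, Quot.mk SP a = Quot.mk SP b ↔ SP a b := fun a b ↦ by
    rw [Quot.eq]; exact (primitiveSpecialPoints_equivalence t).eqvGen_iff
  refine Finite.of_injective (Quot.map (fun p : {τ : ℂ // 0 < τ.im ∧ ∃ x : ℤ × ℤ × ℤ, (∃ u : ℤ × ℤ × ℤ, u.1 * x.1 + u.2.1 * x.2.1 + u.2.2 * x.2.2 = 1) ∧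
        x.1 ^ 2 - 3 * x.2.1 ^ 2 - 3 * x.2.2 ^ 2 = t ∧
        moebius (rho (-1) 3 (by norm_num) (castQ (-1) 3 (⟨0, x.1, x.2.1, x.2.2⟩ : ℍ[ℚ,((-1 : ℤ) : ℚ),((3 : ℤ) : ℚ)]))) τ = τ} ↦
      (⟨p.1, p.2.1, specialPoint_of_primitive p.2.2⟩ : {τ : ℂ // 0 < τ.im ∧ ∃ x : ℍ[ℚ,((-1 : ℤ) : ℚ),((3 : ℤ) : ℚ)],
        x ∈ order (-1) 3 ∧ x.re = 0 ∧ (x * star x).re = t ∧ moebius (rho (-1) 3 (by norm_num) (castQ (-1) 3 x)) τ = τ})) (fun a b h ↦ h) : Quot SP → Quot S) ?_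
  intro a b
  induction a using Quot.ind with
  | _ a =>
    induction b using Quot.ind with
    | _ b =>
      intro h
      exact (hiffP a b).2 ((hiff _ _).1 h)

/-- **`Pt₁(t)/Γ₆⁺` IS FINITE** (`t > 0`). [cite: KudlaRapoportYang2006, §3.4 Lemma 3.4.3] [cite: BayerTravesa2007, §2] -/
theorem finite_primitive_specialPointsPlus {t : ℤ} (ht : 0 < t) :
    Finite (Quot (fun p q : {τ : ℂ // 0 < τ.im ∧ ∃ x : ℤ × ℤ × ℤ, (∃ u : ℤ × ℤ × ℤ, u.1 * x.1 + u.2.1 * x.2.1 + u.2.2 * x.2.2 = 1) ∧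
        x.1 ^ 2 - 3 * x.2.1 ^ 2 - 3 * x.2.2 ^ 2 = t ∧
        moebius (rho (-1) 3 (by norm_num) (castQ (-1) 3 (⟨0, x.1, x.2.1, x.2.2⟩ : ℍ[ℚ,((-1 : ℤ) : ℚ),((3 : ℤ) : ℚ)]))) τ = τ} ↦
      ∃ g : ℍ[ℚ,((-1 : ℤ) : ℚ),((3 : ℤ) : ℚ)], g ≠ 0 ∧
        (∀ a : ℍ[ℚ,((-1 : ℤ) : ℚ),((3 : ℤ) : ℚ)], (a ∈ order (-1) 3 ∨ a - ⟨1/2, 1/2, 1/2, -1/2⟩ ∈ order (-1) 3) →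
          ∃ b : ℍ[ℚ,((-1 : ℤ) : ℚ),((3 : ℤ) : ℚ)], (b ∈ order (-1) 3 ∨ b - ⟨1/2, 1/2, 1/2, -1/2⟩ ∈ order (-1) 3) ∧
            g * a = b * g) ∧
        0 < (g * star g).re ∧ moebius (rho (-1) 3 (by norm_num) (castQ (-1) 3 g)) p.1 = q.1)) := by
  set P : {τ : ℂ // 0 < τ.im ∧ ∃ x : ℍ[ℚ,((-1 : ℤ) : ℚ),((3 : ℤ) : ℚ)],
        x ∈ order (-1) 3 ∧ x.re = 0 ∧ (x * star x).re = t ∧ moebius (rho (-1) 3 (by norm_num) (castQ (-1) 3 x)) τ = τ} →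
      {τ : ℂ // 0 < τ.im ∧ ∃ x : ℍ[ℚ,((-1 : ℤ) : ℚ),((3 : ℤ) : ℚ)],
        x ∈ order (-1) 3 ∧ x.re = 0 ∧ (x * star x).re = t ∧ moebius (rho (-1) 3 (by norm_num) (castQ (-1) 3 x)) τ = τ} → Prop :=
    fun p q ↦ ∃ g : ℍ[ℚ,((-1 : ℤ) : ℚ),((3 : ℤ) : ℚ)], g ≠ 0 ∧
        (∀ a : ℍ[ℚ,((-1 : ℤ) : ℚ),((3 : ℤ) : ℚ)], (a ∈ order (-1) 3 ∨ a - ⟨1/2, 1/2, 1/2, -1/2⟩ ∈ order (-1) 3) →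
          ∃ b : ℍ[ℚ,((-1 : ℤ) : ℚ),((3 : ℤ) : ℚ)], (b ∈ order (-1) 3 ∨ b - ⟨1/2, 1/2, 1/2, -1/2⟩ ∈ order (-1) 3) ∧
            g * a = b * g) ∧
        0 < (g * star g).re ∧ moebius (rho (-1) 3 (by norm_num) (castQ (-1) 3 g)) p.1 = q.1 with hP
  set PP : {τ : ℂ // 0 < τ.im ∧ ∃ x : ℤ × ℤ × ℤ, (∃ u : ℤ × ℤ × ℤ, u.1 * x.1 + u.2.1 * x.2.1 + u.2.2 * x.2.2 = 1) ∧
        x.1 ^ 2 - 3 * x.2.1 ^ 2 - 3 * x.2.2 ^ 2 = t ∧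
        moebius (rho (-1) 3 (by norm_num) (castQ (-1) 3 (⟨0, x.1, x.2.1, x.2.2⟩ : ℍ[ℚ,((-1 : ℤ) : ℚ),((3 : ℤ) : ℚ)]))) τ = τ} →
      {τ : ℂ // 0 < τ.im ∧ ∃ x : ℤ × ℤ × ℤ, (∃ u : ℤ × ℤ × ℤ, u.1 * x.1 + u.2.1 * x.2.1 + u.2.2 * x.2.2 = 1) ∧
        x.1 ^ 2 - 3 * x.2.1 ^ 2 - 3 * x.2.2 ^ 2 = t ∧
        moebius (rho (-1) 3 (by norm_num) (castQ (-1) 3 (⟨0, x.1, x.2.1, x.2.2⟩ : ℍ[ℚ,((-1 : ℤ) : ℚ),((3 : ℤ) : ℚ)]))) τ = τ} → Prop :=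
    fun p q ↦ ∃ g : ℍ[ℚ,((-1 : ℤ) : ℚ),((3 : ℤ) : ℚ)], g ≠ 0 ∧
        (∀ a : ℍ[ℚ,((-1 : ℤ) : ℚ),((3 : ℤ) : ℚ)], (a ∈ order (-1) 3 ∨ a - ⟨1/2, 1/2, 1/2, -1/2⟩ ∈ order (-1) 3) →
          ∃ b : ℍ[ℚ,((-1 : ℤ) : ℚ),((3 : ℤ) : ℚ)], (b ∈ order (-1) 3 ∨ b - ⟨1/2, 1/2, 1/2, -1/2⟩ ∈ order (-1) 3) ∧
            g * a = b * g) ∧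
        0 < (g * star g).re ∧ moebius (rho (-1) 3 (by norm_num) (castQ (-1) 3 g)) p.1 = q.1 with hPP
  haveI : Finite (Quot P) := finite_specialPointsPlus ht
  have hiff : ∀ a b, Quot.mk P a = Quot.mk P b ↔ P a b := specialPointsPlus_mk_eq_iff t
  have hiffP : ∀ a b, Quot.mk PP a = Quot.mk PP b ↔ PP a b := fun a b ↦ by
    rw [Quot.eq]; exact (primitiveSpecialPointsPlus_equivalence t).eqvGen_iff
  refine Finite.of_injective (Quot.map (fun p : {τ : ℂ // 0 < τ.im ∧ ∃ x : ℤ × ℤ × ℤ, (∃ u : ℤ × ℤ × ℤ, u.1 * x.1 + u.2.1 * x.2.1 + u.2.2 * x.2.2 = 1) ∧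
        x.1 ^ 2 - 3 * x.2.1 ^ 2 - 3 * x.2.2 ^ 2 = t ∧
        moebius (rho (-1) 3 (by norm_num) (castQ (-1) 3 (⟨0, x.1, x.2.1, x.2.2⟩ : ℍ[ℚ,((-1 : ℤ) : ℚ),((3 : ℤ) : ℚ)]))) τ = τ} ↦
      (⟨p.1, p.2.1, specialPoint_of_primitive p.2.2⟩ : {τ : ℂ // 0 < τ.im ∧ ∃ x : ℍ[ℚ,((-1 : ℤ) : ℚ),((3 : ℤ) : ℚ)],
        x ∈ order (-1) 3 ∧ x.re = 0 ∧ (x * star x).re = t ∧ moebius (rho (-1) 3 (by norm_num) (castQ (-1) 3 x)) τ = τ})) (fun a b h ↦ h) : Quot PP → Quot P) ?_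
  intro a b
  induction a using Quot.ind with
  | _ a =>
    induction b using Quot.ind with
    | _ b =>
      intro h
      exact (hiffP a b).2 ((hiff _ _).1 h)

/-- **TRANSFER OF FIBRES**: the fibre of `Pt₁(t)/Γ₆ → Pt₁(t)/Γ₆⁺` over the class of a primitive point `p` has as many
classes as the fibre of `Pt(t)/Γ₆ → Pt(t)/Γ₆⁺` over the class of `p` — `[q] ↦ [q]` is injective (same relation on `τ`)
and onto (a point `Γ₆⁺`-equivalent to a primitive point is primitive, `primitive_of_specialPointsPlus_rel`).
[cite: VignerasLNM800, Ch. I §4 p. 26] [cite: KudlaRapoportYang2006, §3.4 (3.4.6), (3.4.11) and Remark 3.4.7] -/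
theorem card_primitive_fibre_eq_card_fibre {t : ℤ} (ht : 0 < t) (p : {τ : ℂ // 0 < τ.im ∧ ∃ x : ℤ × ℤ × ℤ, (∃ u : ℤ × ℤ × ℤ, u.1 * x.1 + u.2.1 * x.2.1 + u.2.2 * x.2.2 = 1) ∧
        x.1 ^ 2 - 3 * x.2.1 ^ 2 - 3 * x.2.2 ^ 2 = t ∧
        moebius (rho (-1) 3 (by norm_num) (castQ (-1) 3 (⟨0, x.1, x.2.1, x.2.2⟩ : ℍ[ℚ,((-1 : ℤ) : ℚ),((3 : ℤ) : ℚ)]))) τ = τ}) :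
    Nat.card {a : Quot (fun p q : {τ : ℂ // 0 < τ.im ∧ ∃ x : ℤ × ℤ × ℤ, (∃ u : ℤ × ℤ × ℤ, u.1 * x.1 + u.2.1 * x.2.1 + u.2.2 * x.2.2 = 1) ∧
        x.1 ^ 2 - 3 * x.2.1 ^ 2 - 3 * x.2.2 ^ 2 = t ∧
        moebius (rho (-1) 3 (by norm_num) (castQ (-1) 3 (⟨0, x.1, x.2.1, x.2.2⟩ : ℍ[ℚ,((-1 : ℤ) : ℚ),((3 : ℤ) : ℚ)]))) τ = τ} ↦
      ∃ v : ℍ[ℚ,((-1 : ℤ) : ℚ),((3 : ℤ) : ℚ)], (v ∈ order (-1) 3 ∨ v - ⟨1/2, 1/2, 1/2, -1/2⟩ ∈ order (-1) 3) ∧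
        v * star v = 1 ∧ moebius (rho (-1) 3 (by norm_num) (castQ (-1) 3 v)) p.1 = q.1) //
      Quot.factor
      (fun p q : {τ : ℂ // 0 < τ.im ∧ ∃ x : ℤ × ℤ × ℤ, (∃ u : ℤ × ℤ × ℤ, u.1 * x.1 + u.2.1 * x.2.1 + u.2.2 * x.2.2 = 1) ∧
        x.1 ^ 2 - 3 * x.2.1 ^ 2 - 3 * x.2.2 ^ 2 = t ∧
        moebius (rho (-1) 3 (by norm_num) (castQ (-1) 3 (⟨0, x.1, x.2.1, x.2.2⟩ : ℍ[ℚ,((-1 : ℤ) : ℚ),((3 : ℤ) : ℚ)]))) τ = τ} ↦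
        ∃ v : ℍ[ℚ,((-1 : ℤ) : ℚ),((3 : ℤ) : ℚ)], (v ∈ order (-1) 3 ∨ v - ⟨1/2, 1/2, 1/2, -1/2⟩ ∈ order (-1) 3) ∧
        v * star v = 1 ∧ moebius (rho (-1) 3 (by norm_num) (castQ (-1) 3 v)) p.1 = q.1)
      (fun p q : {τ : ℂ // 0 < τ.im ∧ ∃ x : ℤ × ℤ × ℤ, (∃ u : ℤ × ℤ × ℤ, u.1 * x.1 + u.2.1 * x.2.1 + u.2.2 * x.2.2 = 1) ∧
        x.1 ^ 2 - 3 * x.2.1 ^ 2 - 3 * x.2.2 ^ 2 = t ∧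
        moebius (rho (-1) 3 (by norm_num) (castQ (-1) 3 (⟨0, x.1, x.2.1, x.2.2⟩ : ℍ[ℚ,((-1 : ℤ) : ℚ),((3 : ℤ) : ℚ)]))) τ = τ} ↦
        ∃ g : ℍ[ℚ,((-1 : ℤ) : ℚ),((3 : ℤ) : ℚ)], g ≠ 0 ∧
        (∀ a : ℍ[ℚ,((-1 : ℤ) : ℚ),((3 : ℤ) : ℚ)], (a ∈ order (-1) 3 ∨ a - ⟨1/2, 1/2, 1/2, -1/2⟩ ∈ order (-1) 3) →
          ∃ b : ℍ[ℚ,((-1 : ℤ) : ℚ),((3 : ℤ) : ℚ)], (b ∈ order (-1) 3 ∨ b - ⟨1/2, 1/2, 1/2, -1/2⟩ ∈ order (-1) 3) ∧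
            g * a = b * g) ∧
        0 < (g * star g).re ∧ moebius (rho (-1) 3 (by norm_num) (castQ (-1) 3 g)) p.1 = q.1)
      (primitiveSpecialPointsPlus_rel_of_rel t) a = Quot.mk _ p} =
    Nat.card {a : Quot (fun p q : {τ : ℂ // 0 < τ.im ∧ ∃ x : ℍ[ℚ,((-1 : ℤ) : ℚ),((3 : ℤ) : ℚ)],
        x ∈ order (-1) 3 ∧ x.re = 0 ∧ (x * star x).re = t ∧ moebius (rho (-1) 3 (by norm_num) (castQ (-1) 3 x)) τ = τ} ↦
      ∃ v : ℍ[ℚ,((-1 : ℤ) : ℚ),((3 : ℤ) : ℚ)], (v ∈ order (-1) 3 ∨ v - ⟨1/2, 1/2, 1/2, -1/2⟩ ∈ order (-1) 3) ∧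
        v * star v = 1 ∧ moebius (rho (-1) 3 (by norm_num) (castQ (-1) 3 v)) p.1 = q.1) //
      Quot.factor
      (fun p q : {τ : ℂ // 0 < τ.im ∧ ∃ x : ℍ[ℚ,((-1 : ℤ) : ℚ),((3 : ℤ) : ℚ)],
        x ∈ order (-1) 3 ∧ x.re = 0 ∧ (x * star x).re = t ∧ moebius (rho (-1) 3 (by norm_num) (castQ (-1) 3 x)) τ = τ} ↦
        ∃ v : ℍ[ℚ,((-1 : ℤ) : ℚ),((3 : ℤ) : ℚ)], (v ∈ order (-1) 3 ∨ v - ⟨1/2, 1/2, 1/2, -1/2⟩ ∈ order (-1) 3) ∧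
        v * star v = 1 ∧ moebius (rho (-1) 3 (by norm_num) (castQ (-1) 3 v)) p.1 = q.1)
      (fun p q : {τ : ℂ // 0 < τ.im ∧ ∃ x : ℍ[ℚ,((-1 : ℤ) : ℚ),((3 : ℤ) : ℚ)],
        x ∈ order (-1) 3 ∧ x.re = 0 ∧ (x * star x).re = t ∧ moebius (rho (-1) 3 (by norm_num) (castQ (-1) 3 x)) τ = τ} ↦
        ∃ g : ℍ[ℚ,((-1 : ℤ) : ℚ),((3 : ℤ) : ℚ)], g ≠ 0 ∧
        (∀ a : ℍ[ℚ,((-1 : ℤ) : ℚ),((3 : ℤ) : ℚ)], (a ∈ order (-1) 3 ∨ a - ⟨1/2, 1/2, 1/2, -1/2⟩ ∈ order (-1) 3) →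
          ∃ b : ℍ[ℚ,((-1 : ℤ) : ℚ),((3 : ℤ) : ℚ)], (b ∈ order (-1) 3 ∨ b - ⟨1/2, 1/2, 1/2, -1/2⟩ ∈ order (-1) 3) ∧
            g * a = b * g) ∧
        0 < (g * star g).re ∧ moebius (rho (-1) 3 (by norm_num) (castQ (-1) 3 g)) p.1 = q.1)
      (specialPointsPlus_rel_of_specialPoints_rel t) a = Quot.mk _ ⟨p.1, p.2.1, specialPoint_of_primitive p.2.2⟩} := by
  -- the four relations and their class criteria
  set S : {τ : ℂ // 0 < τ.im ∧ ∃ x : ℍ[ℚ,((-1 : ℤ) : ℚ),((3 : ℤ) : ℚ)],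
        x ∈ order (-1) 3 ∧ x.re = 0 ∧ (x * star x).re = t ∧ moebius (rho (-1) 3 (by norm_num) (castQ (-1) 3 x)) τ = τ} →
      {τ : ℂ // 0 < τ.im ∧ ∃ x : ℍ[ℚ,((-1 : ℤ) : ℚ),((3 : ℤ) : ℚ)],
        x ∈ order (-1) 3 ∧ x.re = 0 ∧ (x * star x).re = t ∧ moebius (rho (-1) 3 (by norm_num) (castQ (-1) 3 x)) τ = τ} → Prop :=
    fun p q ↦ ∃ v : ℍ[ℚ,((-1 : ℤ) : ℚ),((3 : ℤ) : ℚ)], (v ∈ order (-1) 3 ∨ v - ⟨1/2, 1/2, 1/2, -1/2⟩ ∈ order (-1) 3) ∧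
        v * star v = 1 ∧ moebius (rho (-1) 3 (by norm_num) (castQ (-1) 3 v)) p.1 = q.1 with hS
  set P : {τ : ℂ // 0 < τ.im ∧ ∃ x : ℍ[ℚ,((-1 : ℤ) : ℚ),((3 : ℤ) : ℚ)],
        x ∈ order (-1) 3 ∧ x.re = 0 ∧ (x * star x).re = t ∧ moebius (rho (-1) 3 (by norm_num) (castQ (-1) 3 x)) τ = τ} →
      {τ : ℂ // 0 < τ.im ∧ ∃ x : ℍ[ℚ,((-1 : ℤ) : ℚ),((3 : ℤ) : ℚ)],
        x ∈ order (-1) 3 ∧ x.re = 0 ∧ (x * star x).re = t ∧ moebius (rho (-1) 3 (by norm_num) (castQ (-1) 3 x)) τ = τ} → Prop :=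
    fun p q ↦ ∃ g : ℍ[ℚ,((-1 : ℤ) : ℚ),((3 : ℤ) : ℚ)], g ≠ 0 ∧
        (∀ a : ℍ[ℚ,((-1 : ℤ) : ℚ),((3 : ℤ) : ℚ)], (a ∈ order (-1) 3 ∨ a - ⟨1/2, 1/2, 1/2, -1/2⟩ ∈ order (-1) 3) →
          ∃ b : ℍ[ℚ,((-1 : ℤ) : ℚ),((3 : ℤ) : ℚ)], (b ∈ order (-1) 3 ∨ b - ⟨1/2, 1/2, 1/2, -1/2⟩ ∈ order (-1) 3) ∧
            g * a = b * g) ∧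
        0 < (g * star g).re ∧ moebius (rho (-1) 3 (by norm_num) (castQ (-1) 3 g)) p.1 = q.1 with hP
  set SP : {τ : ℂ // 0 < τ.im ∧ ∃ x : ℤ × ℤ × ℤ, (∃ u : ℤ × ℤ × ℤ, u.1 * x.1 + u.2.1 * x.2.1 + u.2.2 * x.2.2 = 1) ∧
        x.1 ^ 2 - 3 * x.2.1 ^ 2 - 3 * x.2.2 ^ 2 = t ∧
        moebius (rho (-1) 3 (by norm_num) (castQ (-1) 3 (⟨0, x.1, x.2.1, x.2.2⟩ : ℍ[ℚ,((-1 : ℤ) : ℚ),((3 : ℤ) : ℚ)]))) τ = τ} →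
      {τ : ℂ // 0 < τ.im ∧ ∃ x : ℤ × ℤ × ℤ, (∃ u : ℤ × ℤ × ℤ, u.1 * x.1 + u.2.1 * x.2.1 + u.2.2 * x.2.2 = 1) ∧
        x.1 ^ 2 - 3 * x.2.1 ^ 2 - 3 * x.2.2 ^ 2 = t ∧
        moebius (rho (-1) 3 (by norm_num) (castQ (-1) 3 (⟨0, x.1, x.2.1, x.2.2⟩ : ℍ[ℚ,((-1 : ℤ) : ℚ),((3 : ℤ) : ℚ)]))) τ = τ} → Prop :=
    fun p q ↦ ∃ v : ℍ[ℚ,((-1 : ℤ) : ℚ),((3 : ℤ) : ℚ)], (v ∈ order (-1) 3 ∨ v - ⟨1/2, 1/2, 1/2, -1/2⟩ ∈ order (-1) 3) ∧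
        v * star v = 1 ∧ moebius (rho (-1) 3 (by norm_num) (castQ (-1) 3 v)) p.1 = q.1 with hSP
  set PP : {τ : ℂ // 0 < τ.im ∧ ∃ x : ℤ × ℤ × ℤ, (∃ u : ℤ × ℤ × ℤ, u.1 * x.1 + u.2.1 * x.2.1 + u.2.2 * x.2.2 = 1) ∧
        x.1 ^ 2 - 3 * x.2.1 ^ 2 - 3 * x.2.2 ^ 2 = t ∧
        moebius (rho (-1) 3 (by norm_num) (castQ (-1) 3 (⟨0, x.1, x.2.1, x.2.2⟩ : ℍ[ℚ,((-1 : ℤ) : ℚ),((3 : ℤ) : ℚ)]))) τ = τ} →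
      {τ : ℂ // 0 < τ.im ∧ ∃ x : ℤ × ℤ × ℤ, (∃ u : ℤ × ℤ × ℤ, u.1 * x.1 + u.2.1 * x.2.1 + u.2.2 * x.2.2 = 1) ∧
        x.1 ^ 2 - 3 * x.2.1 ^ 2 - 3 * x.2.2 ^ 2 = t ∧
        moebius (rho (-1) 3 (by norm_num) (castQ (-1) 3 (⟨0, x.1, x.2.1, x.2.2⟩ : ℍ[ℚ,((-1 : ℤ) : ℚ),((3 : ℤ) : ℚ)]))) τ = τ} → Prop :=
    fun p q ↦ ∃ g : ℍ[ℚ,((-1 : ℤ) : ℚ),((3 : ℤ) : ℚ)], g ≠ 0 ∧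
        (∀ a : ℍ[ℚ,((-1 : ℤ) : ℚ),((3 : ℤ) : ℚ)], (a ∈ order (-1) 3 ∨ a - ⟨1/2, 1/2, 1/2, -1/2⟩ ∈ order (-1) 3) →
          ∃ b : ℍ[ℚ,((-1 : ℤ) : ℚ),((3 : ℤ) : ℚ)], (b ∈ order (-1) 3 ∨ b - ⟨1/2, 1/2, 1/2, -1/2⟩ ∈ order (-1) 3) ∧
            g * a = b * g) ∧
        0 < (g * star g).re ∧ moebius (rho (-1) 3 (by norm_num) (castQ (-1) 3 g)) p.1 = q.1 with hPP
  have hiff : ∀ a b, Quot.mk S a = Quot.mk S b ↔ S a b := specialPoints_mk_eq_iff t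
  have hiffP : ∀ a b, Quot.mk P a = Quot.mk P b ↔ P a b := specialPointsPlus_mk_eq_iff t
  have hiffSP : ∀ a b, Quot.mk SP a = Quot.mk SP b ↔ SP a b := fun a b ↦ by
    rw [Quot.eq]; exact (primitiveSpecialPoints_equivalence t).eqvGen_iff
  have hiffPP : ∀ a b, Quot.mk PP a = Quot.mk PP b ↔ PP a b := fun a b ↦ by
    rw [Quot.eq]; exact (primitiveSpecialPointsPlus_equivalence t).eqvGen_iff
  have hEP : Equivalence P := specialPointsPlus_equivalence t
  have hEPP : Equivalence PP := primitiveSpecialPointsPlus_equivalence t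
  -- the inclusion `ι : Pt₁(t) → Pt(t)` and the induced map on `Γ₆`-classes
  set ι : {τ : ℂ // 0 < τ.im ∧ ∃ x : ℤ × ℤ × ℤ, (∃ u : ℤ × ℤ × ℤ, u.1 * x.1 + u.2.1 * x.2.1 + u.2.2 * x.2.2 = 1) ∧
        x.1 ^ 2 - 3 * x.2.1 ^ 2 - 3 * x.2.2 ^ 2 = t ∧
        moebius (rho (-1) 3 (by norm_num) (castQ (-1) 3 (⟨0, x.1, x.2.1, x.2.2⟩ : ℍ[ℚ,((-1 : ℤ) : ℚ),((3 : ℤ) : ℚ)]))) τ = τ} →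
      {τ : ℂ // 0 < τ.im ∧ ∃ x : ℍ[ℚ,((-1 : ℤ) : ℚ),((3 : ℤ) : ℚ)],
        x ∈ order (-1) 3 ∧ x.re = 0 ∧ (x * star x).re = t ∧ moebius (rho (-1) 3 (by norm_num) (castQ (-1) 3 x)) τ = τ} :=
    fun a ↦ ⟨a.1, a.2.1, specialPoint_of_primitive a.2.2⟩ with hι
  set ιS : Quot SP → Quot S := Quot.map ι (fun a b h ↦ h) with hιS
  have hπ : ∀ a : Quot SP, Quot.factor SP PP (primitiveSpecialPointsPlus_rel_of_rel t) a = Quot.mk PP p →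
      Quot.factor S P (specialPointsPlus_rel_of_specialPoints_rel t) (ιS a) = Quot.mk P (ι p) := by
    intro a
    induction a using Quot.ind with
    | _ q =>
      intro h
      change Quot.mk PP q = Quot.mk PP p at h
      change Quot.mk P (ι q) = Quot.mk P (ι p)
      rw [hiffPP] at h
      exact (hiffP _ _).2 h
  set Φ : {a : Quot SP // Quot.factor SP PP (primitiveSpecialPointsPlus_rel_of_rel t) a = Quot.mk PP p} →
      {a : Quot S // Quot.factor S P (specialPointsPlus_rel_of_specialPoints_rel t) a = Quot.mk P (ι p)} :=
    fun a ↦ ⟨ιS a.1, hπ a.1 a.2⟩ with hΦ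
  refine Nat.card_eq_of_bijective Φ ⟨?_, ?_⟩
  · rintro ⟨a, ha⟩ ⟨b, hb⟩ h
    apply Subtype.ext
    have h' : ιS a = ιS b := congrArg Subtype.val h
    induction a using Quot.ind with
    | _ a =>
      induction b using Quot.ind with
      | _ b =>
        change Quot.mk S (ι a) = Quot.mk S (ι b) at h'
        rw [hiff] at h'
        exact (hiffSP a b).2 h'
  · rintro ⟨b, hb⟩
    induction b using Quot.ind with
    | _ q' =>
      change Quot.mk P q' = Quot.mk P (ι p) at hb
      rw [hiffP] at hb
      -- `p ∼ q'` under `Γ₆⁺`, so `q'` is primitive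
      have hrel : P (ι p) q' := hEP.symm hb
      have hq' := primitive_of_specialPointsPlus_rel ht (ι p) q' p.2.2 hrel
      refine ⟨⟨Quot.mk SP ⟨q'.1, q'.2.1, hq'⟩, ?_⟩, ?_⟩
      · change Quot.mk PP ⟨q'.1, q'.2.1, hq'⟩ = Quot.mk PP p
        rw [hiffPP]
        exact hEPP.symm (x := p) (y := ⟨q'.1, q'.2.1, hq'⟩) hrel
      · apply Subtype.ext
        change Quot.mk S (ι ⟨q'.1, q'.2.1, hq'⟩) = Quot.mk S q'
        rfl

/-- **EVERY FIBRE OF `Pt₁(t)/Γ₆ → Pt₁(t)/Γ₆⁺` HAS FOUR CLASSES** (`t > 0`, `t ∉ {1, 3, 6}`): `W ≅ (ℤ/2ℤ)²` acts FREELY on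
the points of `Z_prim(t)` on `X₆`. [cite: KudlaRapoportYang2006, §3.4 Remark 3.4.7 and (3.4.6)] [cite: Ogg1983RealPoints, §2 (2)–(4)] [cite: BayerTravesa2007, §2] [cite: VignerasLNM800, Ch. IV §3 B] -/
theorem card_primitive_fibre_eq_four {t : ℤ} (ht : 0 < t) (h136 : t ≠ 1 ∧ t ≠ 3 ∧ t ≠ 6)
    (c : Quot (fun p q : {τ : ℂ // 0 < τ.im ∧ ∃ x : ℤ × ℤ × ℤ, (∃ u : ℤ × ℤ × ℤ, u.1 * x.1 + u.2.1 * x.2.1 + u.2.2 * x.2.2 = 1) ∧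
        x.1 ^ 2 - 3 * x.2.1 ^ 2 - 3 * x.2.2 ^ 2 = t ∧
        moebius (rho (-1) 3 (by norm_num) (castQ (-1) 3 (⟨0, x.1, x.2.1, x.2.2⟩ : ℍ[ℚ,((-1 : ℤ) : ℚ),((3 : ℤ) : ℚ)]))) τ = τ} ↦
      ∃ g : ℍ[ℚ,((-1 : ℤ) : ℚ),((3 : ℤ) : ℚ)], g ≠ 0 ∧
        (∀ a : ℍ[ℚ,((-1 : ℤ) : ℚ),((3 : ℤ) : ℚ)], (a ∈ order (-1) 3 ∨ a - ⟨1/2, 1/2, 1/2, -1/2⟩ ∈ order (-1) 3) →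
          ∃ b : ℍ[ℚ,((-1 : ℤ) : ℚ),((3 : ℤ) : ℚ)], (b ∈ order (-1) 3 ∨ b - ⟨1/2, 1/2, 1/2, -1/2⟩ ∈ order (-1) 3) ∧
            g * a = b * g) ∧
        0 < (g * star g).re ∧ moebius (rho (-1) 3 (by norm_num) (castQ (-1) 3 g)) p.1 = q.1)) :
    Nat.card {a : Quot (fun p q : {τ : ℂ // 0 < τ.im ∧ ∃ x : ℤ × ℤ × ℤ, (∃ u : ℤ × ℤ × ℤ, u.1 * x.1 + u.2.1 * x.2.1 + u.2.2 * x.2.2 = 1) ∧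
        x.1 ^ 2 - 3 * x.2.1 ^ 2 - 3 * x.2.2 ^ 2 = t ∧
        moebius (rho (-1) 3 (by norm_num) (castQ (-1) 3 (⟨0, x.1, x.2.1, x.2.2⟩ : ℍ[ℚ,((-1 : ℤ) : ℚ),((3 : ℤ) : ℚ)]))) τ = τ} ↦
      ∃ v : ℍ[ℚ,((-1 : ℤ) : ℚ),((3 : ℤ) : ℚ)], (v ∈ order (-1) 3 ∨ v - ⟨1/2, 1/2, 1/2, -1/2⟩ ∈ order (-1) 3) ∧
        v * star v = 1 ∧ moebius (rho (-1) 3 (by norm_num) (castQ (-1) 3 v)) p.1 = q.1) //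
      Quot.factor
      (fun p q : {τ : ℂ // 0 < τ.im ∧ ∃ x : ℤ × ℤ × ℤ, (∃ u : ℤ × ℤ × ℤ, u.1 * x.1 + u.2.1 * x.2.1 + u.2.2 * x.2.2 = 1) ∧
        x.1 ^ 2 - 3 * x.2.1 ^ 2 - 3 * x.2.2 ^ 2 = t ∧
        moebius (rho (-1) 3 (by norm_num) (castQ (-1) 3 (⟨0, x.1, x.2.1, x.2.2⟩ : ℍ[ℚ,((-1 : ℤ) : ℚ),((3 : ℤ) : ℚ)]))) τ = τ} ↦
        ∃ v : ℍ[ℚ,((-1 : ℤ) : ℚ),((3 : ℤ) : ℚ)], (v ∈ order (-1) 3 ∨ v - ⟨1/2, 1/2, 1/2, -1/2⟩ ∈ order (-1) 3) ∧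
        v * star v = 1 ∧ moebius (rho (-1) 3 (by norm_num) (castQ (-1) 3 v)) p.1 = q.1)
      (fun p q : {τ : ℂ // 0 < τ.im ∧ ∃ x : ℤ × ℤ × ℤ, (∃ u : ℤ × ℤ × ℤ, u.1 * x.1 + u.2.1 * x.2.1 + u.2.2 * x.2.2 = 1) ∧
        x.1 ^ 2 - 3 * x.2.1 ^ 2 - 3 * x.2.2 ^ 2 = t ∧
        moebius (rho (-1) 3 (by norm_num) (castQ (-1) 3 (⟨0, x.1, x.2.1, x.2.2⟩ : ℍ[ℚ,((-1 : ℤ) : ℚ),((3 : ℤ) : ℚ)]))) τ = τ} ↦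
        ∃ g : ℍ[ℚ,((-1 : ℤ) : ℚ),((3 : ℤ) : ℚ)], g ≠ 0 ∧
        (∀ a : ℍ[ℚ,((-1 : ℤ) : ℚ),((3 : ℤ) : ℚ)], (a ∈ order (-1) 3 ∨ a - ⟨1/2, 1/2, 1/2, -1/2⟩ ∈ order (-1) 3) →
          ∃ b : ℍ[ℚ,((-1 : ℤ) : ℚ),((3 : ℤ) : ℚ)], (b ∈ order (-1) 3 ∨ b - ⟨1/2, 1/2, 1/2, -1/2⟩ ∈ order (-1) 3) ∧
            g * a = b * g) ∧
        0 < (g * star g).re ∧ moebius (rho (-1) 3 (by norm_num) (castQ (-1) 3 g)) p.1 = q.1)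
      (primitiveSpecialPointsPlus_rel_of_rel t) a = c} = 4 := by
  induction c using Quot.ind with
  | _ p =>
    rw [card_primitive_fibre_eq_card_fibre ht p]
    exact card_fibre_eq_four_of_primitive h136 _ p.2.2

/-- **EVERY FIBRE OF `Pt₁(t)/Γ₆ → Pt₁(t)/Γ₆⁺` HAS TWO CLASSES for `t ∈ {1, 3, 6}`** (`Pt₁(t) = Pt(t)` consists of
`Z(t)`-points, all fixed by `ω₂`, `ω₃` resp. `ω₆`). [cite: Ogg1983RealPoints, §2 p. 284 and (4)] [cite: BayerTravesa2007, §1 Thm. 1.1 and §7 Table 9] -/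
theorem card_primitive_fibre_eq_two {t : ℤ} (h136 : t = 1 ∨ t = 3 ∨ t = 6)
    (c : Quot (fun p q : {τ : ℂ // 0 < τ.im ∧ ∃ x : ℤ × ℤ × ℤ, (∃ u : ℤ × ℤ × ℤ, u.1 * x.1 + u.2.1 * x.2.1 + u.2.2 * x.2.2 = 1) ∧
        x.1 ^ 2 - 3 * x.2.1 ^ 2 - 3 * x.2.2 ^ 2 = t ∧
        moebius (rho (-1) 3 (by norm_num) (castQ (-1) 3 (⟨0, x.1, x.2.1, x.2.2⟩ : ℍ[ℚ,((-1 : ℤ) : ℚ),((3 : ℤ) : ℚ)]))) τ = τ} ↦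
      ∃ g : ℍ[ℚ,((-1 : ℤ) : ℚ),((3 : ℤ) : ℚ)], g ≠ 0 ∧
        (∀ a : ℍ[ℚ,((-1 : ℤ) : ℚ),((3 : ℤ) : ℚ)], (a ∈ order (-1) 3 ∨ a - ⟨1/2, 1/2, 1/2, -1/2⟩ ∈ order (-1) 3) →
          ∃ b : ℍ[ℚ,((-1 : ℤ) : ℚ),((3 : ℤ) : ℚ)], (b ∈ order (-1) 3 ∨ b - ⟨1/2, 1/2, 1/2, -1/2⟩ ∈ order (-1) 3) ∧
            g * a = b * g) ∧
        0 < (g * star g).re ∧ moebius (rho (-1) 3 (by norm_num) (castQ (-1) 3 g)) p.1 = q.1)) :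
    Nat.card {a : Quot (fun p q : {τ : ℂ // 0 < τ.im ∧ ∃ x : ℤ × ℤ × ℤ, (∃ u : ℤ × ℤ × ℤ, u.1 * x.1 + u.2.1 * x.2.1 + u.2.2 * x.2.2 = 1) ∧
        x.1 ^ 2 - 3 * x.2.1 ^ 2 - 3 * x.2.2 ^ 2 = t ∧
        moebius (rho (-1) 3 (by norm_num) (castQ (-1) 3 (⟨0, x.1, x.2.1, x.2.2⟩ : ℍ[ℚ,((-1 : ℤ) : ℚ),((3 : ℤ) : ℚ)]))) τ = τ} ↦
      ∃ v : ℍ[ℚ,((-1 : ℤ) : ℚ),((3 : ℤ) : ℚ)], (v ∈ order (-1) 3 ∨ v - ⟨1/2, 1/2, 1/2, -1/2⟩ ∈ order (-1) 3) ∧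
        v * star v = 1 ∧ moebius (rho (-1) 3 (by norm_num) (castQ (-1) 3 v)) p.1 = q.1) //
      Quot.factor
      (fun p q : {τ : ℂ // 0 < τ.im ∧ ∃ x : ℤ × ℤ × ℤ, (∃ u : ℤ × ℤ × ℤ, u.1 * x.1 + u.2.1 * x.2.1 + u.2.2 * x.2.2 = 1) ∧
        x.1 ^ 2 - 3 * x.2.1 ^ 2 - 3 * x.2.2 ^ 2 = t ∧
        moebius (rho (-1) 3 (by norm_num) (castQ (-1) 3 (⟨0, x.1, x.2.1, x.2.2⟩ : ℍ[ℚ,((-1 : ℤ) : ℚ),((3 : ℤ) : ℚ)]))) τ = τ} ↦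
        ∃ v : ℍ[ℚ,((-1 : ℤ) : ℚ),((3 : ℤ) : ℚ)], (v ∈ order (-1) 3 ∨ v - ⟨1/2, 1/2, 1/2, -1/2⟩ ∈ order (-1) 3) ∧
        v * star v = 1 ∧ moebius (rho (-1) 3 (by norm_num) (castQ (-1) 3 v)) p.1 = q.1)
      (fun p q : {τ : ℂ // 0 < τ.im ∧ ∃ x : ℤ × ℤ × ℤ, (∃ u : ℤ × ℤ × ℤ, u.1 * x.1 + u.2.1 * x.2.1 + u.2.2 * x.2.2 = 1) ∧
        x.1 ^ 2 - 3 * x.2.1 ^ 2 - 3 * x.2.2 ^ 2 = t ∧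
        moebius (rho (-1) 3 (by norm_num) (castQ (-1) 3 (⟨0, x.1, x.2.1, x.2.2⟩ : ℍ[ℚ,((-1 : ℤ) : ℚ),((3 : ℤ) : ℚ)]))) τ = τ} ↦
        ∃ g : ℍ[ℚ,((-1 : ℤ) : ℚ),((3 : ℤ) : ℚ)], g ≠ 0 ∧
        (∀ a : ℍ[ℚ,((-1 : ℤ) : ℚ),((3 : ℤ) : ℚ)], (a ∈ order (-1) 3 ∨ a - ⟨1/2, 1/2, 1/2, -1/2⟩ ∈ order (-1) 3) →
          ∃ b : ℍ[ℚ,((-1 : ℤ) : ℚ),((3 : ℤ) : ℚ)], (b ∈ order (-1) 3 ∨ b - ⟨1/2, 1/2, 1/2, -1/2⟩ ∈ order (-1) 3) ∧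
            g * a = b * g) ∧
        0 < (g * star g).re ∧ moebius (rho (-1) 3 (by norm_num) (castQ (-1) 3 g)) p.1 = q.1)
      (primitiveSpecialPointsPlus_rel_of_rel t) a = c} = 2 := by
  have ht : 0 < t := by rcases h136 with rfl | rfl | rfl <;> norm_num
  induction c using Quot.ind with
  | _ p =>
    rw [card_primitive_fibre_eq_card_fibre ht p]
    have hmem := specialPoint_of_primitive p.2.2
    rcases h136 with rfl | rfl | rfl
    · exact card_fibre_eq_two_of_mem_one _ (by push_cast at hmem; exact hmem)
    · exact card_fibre_eq_two_of_mem_three _ (by push_cast at hmem; exact hmem)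
    · exact card_fibre_eq_two_of_mem_six _ (by push_cast at hmem; exact hmem)

end Transfer

/-! ## §4 `#(Pt₁(t)/Γ₆) = 4·#(Pt₁(t)/Γ₆⁺)` for `t ∉ {1, 3, 6}`, `= 2·#(Pt₁(t)/Γ₆⁺)` for `t ∈ {1, 3, 6}` -/

section Counts

/-- **`#(Pt₁(t)/Γ₆) = 4·#(Pt₁(t)/Γ₆⁺)` FOR EVERY `t > 0`, `t ∉ {1, 3, 6}`**: the primitive special cycle `Z_prim(t)` on
`X₆` is an unramified four-sheeted cover of its image on `X₆⁺` (the class equation with all fibres of size `4`). E.g.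
`t = 25, 75`: `4 = 4·1` (`card_primitive_specialPoints_twentyfive`, `card_primitive_specialPointsPlus_twentyfive` …);
for squarefree `t ∉ {1, 3, 6}` this is `#(Pt(t)/Γ₆) = 4·#(Pt(t)/Γ₆⁺)` again. [cite: KudlaRapoportYang2006, §3.4 Remark 3.4.7, (3.4.6) and (3.4.13)] [cite: Ogg1983RealPoints, §2 (2)–(4)] [cite: BayerTravesa2007, §2] [cite: VignerasLNM800, Ch. IV §3 B] -/
theorem card_primitive_specialPoints_eq_four_mul {t : ℤ} (ht : 0 < t) (h136 : t ≠ 1 ∧ t ≠ 3 ∧ t ≠ 6) :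
    Nat.card (Quot (fun p q : {τ : ℂ // 0 < τ.im ∧ ∃ x : ℤ × ℤ × ℤ, (∃ u : ℤ × ℤ × ℤ, u.1 * x.1 + u.2.1 * x.2.1 + u.2.2 * x.2.2 = 1) ∧
        x.1 ^ 2 - 3 * x.2.1 ^ 2 - 3 * x.2.2 ^ 2 = t ∧
        moebius (rho (-1) 3 (by norm_num) (castQ (-1) 3 (⟨0, x.1, x.2.1, x.2.2⟩ : ℍ[ℚ,((-1 : ℤ) : ℚ),((3 : ℤ) : ℚ)]))) τ = τ} ↦
      ∃ v : ℍ[ℚ,((-1 : ℤ) : ℚ),((3 : ℤ) : ℚ)], (v ∈ order (-1) 3 ∨ v - ⟨1/2, 1/2, 1/2, -1/2⟩ ∈ order (-1) 3) ∧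
        v * star v = 1 ∧ moebius (rho (-1) 3 (by norm_num) (castQ (-1) 3 v)) p.1 = q.1)) =
    4 * Nat.card (Quot (fun p q : {τ : ℂ // 0 < τ.im ∧ ∃ x : ℤ × ℤ × ℤ, (∃ u : ℤ × ℤ × ℤ, u.1 * x.1 + u.2.1 * x.2.1 + u.2.2 * x.2.2 = 1) ∧
        x.1 ^ 2 - 3 * x.2.1 ^ 2 - 3 * x.2.2 ^ 2 = t ∧
        moebius (rho (-1) 3 (by norm_num) (castQ (-1) 3 (⟨0, x.1, x.2.1, x.2.2⟩ : ℍ[ℚ,((-1 : ℤ) : ℚ),((3 : ℤ) : ℚ)]))) τ = τ} ↦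
      ∃ g : ℍ[ℚ,((-1 : ℤ) : ℚ),((3 : ℤ) : ℚ)], g ≠ 0 ∧
        (∀ a : ℍ[ℚ,((-1 : ℤ) : ℚ),((3 : ℤ) : ℚ)], (a ∈ order (-1) 3 ∨ a - ⟨1/2, 1/2, 1/2, -1/2⟩ ∈ order (-1) 3) →
          ∃ b : ℍ[ℚ,((-1 : ℤ) : ℚ),((3 : ℤ) : ℚ)], (b ∈ order (-1) 3 ∨ b - ⟨1/2, 1/2, 1/2, -1/2⟩ ∈ order (-1) 3) ∧
            g * a = b * g) ∧
        0 < (g * star g).re ∧ moebius (rho (-1) 3 (by norm_num) (castQ (-1) 3 g)) p.1 = q.1)) := by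
  haveI := finite_primitive_specialPoints ht
  haveI := finite_primitive_specialPointsPlus ht
  exact card_eq_mul_of_card_fibre₂₀ _ 4 (card_primitive_fibre_eq_four ht h136)

/-- **`#(Pt₁(t)/Γ₆) = 2·#(Pt₁(t)/Γ₆⁺)` for `t ∈ {1, 3, 6}`** (`2 = 2·1` each time). [cite: Ogg1983RealPoints, §2 p. 284 and (4)] [cite: BayerTravesa2007, §1 Thm. 1.1 and §7 Table 9] -/
theorem card_primitive_specialPoints_eq_two_mul {t : ℤ} (h136 : t = 1 ∨ t = 3 ∨ t = 6) :
    Nat.card (Quot (fun p q : {τ : ℂ // 0 < τ.im ∧ ∃ x : ℤ × ℤ × ℤ, (∃ u : ℤ × ℤ × ℤ, u.1 * x.1 + u.2.1 * x.2.1 + u.2.2 * x.2.2 = 1) ∧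
        x.1 ^ 2 - 3 * x.2.1 ^ 2 - 3 * x.2.2 ^ 2 = t ∧
        moebius (rho (-1) 3 (by norm_num) (castQ (-1) 3 (⟨0, x.1, x.2.1, x.2.2⟩ : ℍ[ℚ,((-1 : ℤ) : ℚ),((3 : ℤ) : ℚ)]))) τ = τ} ↦
      ∃ v : ℍ[ℚ,((-1 : ℤ) : ℚ),((3 : ℤ) : ℚ)], (v ∈ order (-1) 3 ∨ v - ⟨1/2, 1/2, 1/2, -1/2⟩ ∈ order (-1) 3) ∧
        v * star v = 1 ∧ moebius (rho (-1) 3 (by norm_num) (castQ (-1) 3 v)) p.1 = q.1)) =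
    2 * Nat.card (Quot (fun p q : {τ : ℂ // 0 < τ.im ∧ ∃ x : ℤ × ℤ × ℤ, (∃ u : ℤ × ℤ × ℤ, u.1 * x.1 + u.2.1 * x.2.1 + u.2.2 * x.2.2 = 1) ∧
        x.1 ^ 2 - 3 * x.2.1 ^ 2 - 3 * x.2.2 ^ 2 = t ∧
        moebius (rho (-1) 3 (by norm_num) (castQ (-1) 3 (⟨0, x.1, x.2.1, x.2.2⟩ : ℍ[ℚ,((-1 : ℤ) : ℚ),((3 : ℤ) : ℚ)]))) τ = τ} ↦
      ∃ g : ℍ[ℚ,((-1 : ℤ) : ℚ),((3 : ℤ) : ℚ)], g ≠ 0 ∧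
        (∀ a : ℍ[ℚ,((-1 : ℤ) : ℚ),((3 : ℤ) : ℚ)], (a ∈ order (-1) 3 ∨ a - ⟨1/2, 1/2, 1/2, -1/2⟩ ∈ order (-1) 3) →
          ∃ b : ℍ[ℚ,((-1 : ℤ) : ℚ),((3 : ℤ) : ℚ)], (b ∈ order (-1) 3 ∨ b - ⟨1/2, 1/2, 1/2, -1/2⟩ ∈ order (-1) 3) ∧
            g * a = b * g) ∧
        0 < (g * star g).re ∧ moebius (rho (-1) 3 (by norm_num) (castQ (-1) 3 g)) p.1 = q.1)) := by
  have ht : 0 < t := by rcases h136 with rfl | rfl | rfl <;> norm_num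
  haveI := finite_primitive_specialPoints ht
  haveI := finite_primitive_specialPointsPlus ht
  exact card_eq_mul_of_card_fibre₂₀ _ 2 (card_primitive_fibre_eq_two h136)

/-- **`4 ∣ #(Pt₁(t)/Γ₆)` for every `t > 0`, `t ∉ {1, 3, 6}`** (against `#(Pt(t)/Γ₆) ≡ 2 (mod 4)` for the full cycle when
`t ∈ ℤ² ∪ 3ℤ² ∪ 6ℤ²`, `card_specialPoints_mod_four_eq_two_iff`). [cite: KudlaRapoportYang2006, §3.4 Remark 3.4.7 and (3.4.13)] [cite: Ogg1983RealPoints, §2 (2)–(4)] -/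
theorem four_dvd_card_primitive_specialPoints {t : ℤ} (ht : 0 < t) (h136 : t ≠ 1 ∧ t ≠ 3 ∧ t ≠ 6) :
    4 ∣ Nat.card (Quot (fun p q : {τ : ℂ // 0 < τ.im ∧ ∃ x : ℤ × ℤ × ℤ, (∃ u : ℤ × ℤ × ℤ, u.1 * x.1 + u.2.1 * x.2.1 + u.2.2 * x.2.2 = 1) ∧
        x.1 ^ 2 - 3 * x.2.1 ^ 2 - 3 * x.2.2 ^ 2 = t ∧
        moebius (rho (-1) 3 (by norm_num) (castQ (-1) 3 (⟨0, x.1, x.2.1, x.2.2⟩ : ℍ[ℚ,((-1 : ℤ) : ℚ),((3 : ℤ) : ℚ)]))) τ = τ} ↦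
      ∃ v : ℍ[ℚ,((-1 : ℤ) : ℚ),((3 : ℤ) : ℚ)], (v ∈ order (-1) 3 ∨ v - ⟨1/2, 1/2, 1/2, -1/2⟩ ∈ order (-1) 3) ∧
        v * star v = 1 ∧ moebius (rho (-1) 3 (by norm_num) (castQ (-1) 3 v)) p.1 = q.1)) :=
  ⟨_, card_primitive_specialPoints_eq_four_mul ht h136⟩

end Counts

/-! ## §5 The short orbit is imprimitive: the norm-`t` vectors at a `Z(t₀)`-point are `±m·y` -/

section Imprimitive

/-- **THE NORM-`t` VECTORS AT A `Z(t₀)`-POINT ARE `±m·y`** (`t = m²t₀`, `t₀ > 0`): if `τ ∉ ℝ` is fixed by the special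
vectors `x` (norm `t`) and `y` (norm `t₀`), then `x = m·y` or `x = −m·y` — the special vectors at a CM point form a
line (KRY Prop. 3.4.1) and `c²t₀ = m²t₀`. [cite: KudlaRapoportYang2006, §3.4 Prop. 3.4.1 and (3.4.6)] -/
theorem special_eq_smul_or_eq_neg_smul_of_mem {t t₀ m : ℤ} (ht₀ : 0 < t₀) (htm : t = m ^ 2 * t₀) {τ : ℂ}
    (hτ : τ.im ≠ 0) {x y : ℍ[ℚ,((-1 : ℤ) : ℚ),((3 : ℤ) : ℚ)]} (hxre : x.re = 0) (hxn : (x * star x).re = t)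
    (hfx : moebius (rho (-1) 3 (by norm_num) (castQ (-1) 3 x)) τ = τ) (hyre : y.re = 0)
    (hyn : (y * star y).re = t₀) (hfy : moebius (rho (-1) 3 (by norm_num) (castQ (-1) 3 y)) τ = τ) :
    x = (m : ℚ) • y ∨ x = -((m : ℚ) • y) := by
  have ht0q : (0 : ℚ) < t₀ := by exact_mod_cast ht₀
  have hy0 : y ≠ 0 := by
    intro h0
    rw [h0, zero_mul, QuaternionAlgebra.re_zero] at hyn
    rw [← hyn] at ht0q
    exact lt_irrefl _ ht0q
  obtain ⟨c, hc⟩ := exists_eq_smul_of_moebius_eq (a := -1) (b := 3) (by norm_num) (by norm_num) hyre hy0 hxre hτ hfy hfx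
  have hnorm : (t : ℚ) = c ^ 2 * t₀ := by
    rw [← hxn, ← hyn, hc, QuaternionAlgebra.star_smul, smul_mul_smul_comm, QuaternionAlgebra.re_smul, smul_eq_mul, sq]
  have hcm : c ^ 2 = (m : ℚ) ^ 2 := by
    have e : c ^ 2 * (t₀ : ℚ) = (m : ℚ) ^ 2 * t₀ := by rw [← hnorm, htm]; push_cast; ring
    exact mul_right_cancel₀ ht0q.ne' e
  rcases sq_eq_sq_iff_eq_or_eq_neg.1 hcm with h | h
  · exact Or.inl (by rw [hc, h])
  · exact Or.inr (by rw [hc, h, neg_smul])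

/-- **ON `Z(m²t₀) ∩ Z(t₀)` THE COORDINATES OF THE NORM-`m²t₀` VECTORS ARE DIVISIBLE BY `m`**: an integer triple `x` with
`Q(x) = m²t₀` fixing a `Z(t₀)`-point (`t₀ > 0`) is `±m·p` with `p` the integer triple of the `Z(t₀)`-vector — the
short `W`-orbit of `…XSixSpecialPointsFibres` lies in the content-`m` stratum `m·Z_prim(t₀)` of `Z(t)`.
[cite: KudlaRapoportYang2006, §3.4 (3.4.6) («`Σ_{c ∣ n}`») and Prop. 3.4.1] -/
theorem dvd_coords_of_mem_sq_mul {t t₀ m : ℤ} (ht₀ : 0 < t₀) (htm : t = m ^ 2 * t₀) {τ : ℂ} (hτ : τ.im ≠ 0)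
    {x : ℤ × ℤ × ℤ} (hQ : x.1 ^ 2 - 3 * x.2.1 ^ 2 - 3 * x.2.2 ^ 2 = t)
    (hfix : moebius (rho (-1) 3 (by norm_num) (castQ (-1) 3 (⟨0, x.1, x.2.1, x.2.2⟩ : ℍ[ℚ,((-1 : ℤ) : ℚ),((3 : ℤ) : ℚ)]))) τ = τ)
    (hmem : ∃ x : ℍ[ℚ,((-1 : ℤ) : ℚ),((3 : ℤ) : ℚ)], x ∈ order (-1) 3 ∧ x.re = 0 ∧ (x * star x).re = t₀ ∧
        moebius (rho (-1) 3 (by norm_num) (castQ (-1) 3 x)) τ = τ) :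
    m ∣ x.1 ∧ m ∣ x.2.1 ∧ m ∣ x.2.2 := by
  obtain ⟨y, hy, hyre, hyn, hfy⟩ := hmem
  obtain ⟨p, hpe, -⟩ := exists_eq_mk_of_mem_order_re_zero hy hyre
  have hxn : (((⟨0, x.1, x.2.1, x.2.2⟩ : ℍ[ℚ,((-1 : ℤ) : ℚ),((3 : ℤ) : ℚ)])) * star (⟨0, x.1, x.2.1, x.2.2⟩ : ℍ[ℚ,((-1 : ℤ) : ℚ),((3 : ℤ) : ℚ)])).re = (t : ℚ) := by rw [pureVec_norm]; exact_mod_cast hQ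
  have key := special_eq_smul_or_eq_neg_smul_of_mem ht₀ htm hτ rfl hxn hfix hyre hyn hfy
  rw [hpe, QuaternionAlgebra.smul_mk, QuaternionAlgebra.neg_mk] at key
  simp only [smul_eq_mul, mul_zero, neg_zero, QuaternionAlgebra.mk.injEq, true_and] at key
  rcases key with ⟨h1, h2, h3⟩ | ⟨h1, h2, h3⟩
  · exact ⟨⟨p.1, by exact_mod_cast h1⟩, ⟨p.2.1, by exact_mod_cast h2⟩, ⟨p.2.2, by exact_mod_cast h3⟩⟩
  · refine ⟨⟨-p.1, ?_⟩, ⟨-p.2.1, ?_⟩, ⟨-p.2.2, ?_⟩⟩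
    · have e : (x.1 : ℚ) = (m : ℚ) * ((-p.1 : ℤ) : ℚ) := by rw [h1]; push_cast; ring
      exact_mod_cast e
    · have e : (x.2.1 : ℚ) = (m : ℚ) * ((-p.2.1 : ℤ) : ℚ) := by rw [h2]; push_cast; ring
      exact_mod_cast e
    · have e : (x.2.2 : ℚ) = (m : ℚ) * ((-p.2.2 : ℤ) : ℚ) := by rw [h3]; push_cast; ring
      exact_mod_cast e

/-- **… SO THEY ARE IMPRIMITIVE for `|m| ≥ 2`**: the short `W`-orbit of `Z(m²t₀)`, `|m| ≥ 2`, contains no primitive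
point (the converse reading of `eq_of_primitive_of_mem`). [cite: KudlaRapoportYang2006, §3.4 (3.4.6) and Prop. 3.4.1] -/
theorem not_primitive_of_mem_sq_mul {t t₀ m : ℤ} (ht₀ : 0 < t₀) (htm : t = m ^ 2 * t₀) (hm : 2 ≤ |m|) {τ : ℂ}
    (hτ : τ.im ≠ 0) {x : ℤ × ℤ × ℤ} (hQ : x.1 ^ 2 - 3 * x.2.1 ^ 2 - 3 * x.2.2 ^ 2 = t)
    (hfix : moebius (rho (-1) 3 (by norm_num) (castQ (-1) 3 (⟨0, x.1, x.2.1, x.2.2⟩ : ℍ[ℚ,((-1 : ℤ) : ℚ),((3 : ℤ) : ℚ)]))) τ = τ)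
    (hmem : ∃ x : ℍ[ℚ,((-1 : ℤ) : ℚ),((3 : ℤ) : ℚ)], x ∈ order (-1) 3 ∧ x.re = 0 ∧ (x * star x).re = t₀ ∧
        moebius (rho (-1) 3 (by norm_num) (castQ (-1) 3 x)) τ = τ) :
    ¬ ∃ u : ℤ × ℤ × ℤ, u.1 * x.1 + u.2.1 * x.2.1 + u.2.2 * x.2.2 = 1 := by
  rintro ⟨u, hu⟩
  obtain ⟨⟨a, ha⟩, ⟨b, hb⟩, ⟨d, hd⟩⟩ := dvd_coords_of_mem_sq_mul ht₀ htm hτ hQ hfix hmem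
  have hdvd : m ∣ 1 := ⟨u.1 * a + u.2.1 * b + u.2.2 * d, by rw [← hu, ha, hb, hd]; ring⟩
  rcases Int.isUnit_iff.1 (isUnit_of_dvd_one hdvd) with rfl | rfl <;> norm_num at hm

end Imprimitive

end Literature.Geometry.Kaehler.ComplexTorus.QuaternionType
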